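import Literature.MathematicalPhysics.QuantumFieldTheory.Balaban1983to89.B6Prop26KLevelAssemblyV1
import Literature.MathematicalPhysics.QuantumFieldTheory.Balaban1983to89.B6Line3WindowV1
import Literature.MathematicalPhysics.QuantumFieldTheory.Balaban1983to89.B6MemberLevelsWindow
import Literature.MathematicalPhysics.QuantumFieldTheory.Balaban1983to89.B6Line3CutoffV1
import Literature.MathematicalPhysics.QuantumFieldTheory.Balaban1983to89.B6Line3GapV1
import Literature.MathematicalPhysics.QuantumFieldTheory.Balaban1983to89.B6Line3ProfileV1
import HarnessLib

/-!
# `Balaban1983to89.B6Line3CubeV1` — T. Bałaban, *Propagators and renormalization transformations for lattice gauge theories. II*,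
# Commun. Math. Phys. **96** (1984) 223–250 [Balaban1984PropagatorsII], (2.92) p. 239 LINE 3 `ζ_□(∂P∂* − ∂P̃_□∂*)h_□` FOR THE GENUINE MEMBER OF
# EVERY CUBE OF THE k-LEVEL COVER, and PROP. 2.6 (2.136)₁ p. 247 AT k LEVELS WITH NO DISPLAYED ANALYTIC HYPOTHESIS (ROUTE V, step (iv), B6-CLOSURE §5 item 16)

statement-level skeleton of published theorems with citation tags; proofs where landed; nothing here is a claim about the Yang–Mills mass gap

PDF held: `paper:balaban1984-cmp96-propagators-rt-ii` (journal page = PDF page + 222): p. 239 [PDF 17] ((2.92): *"ζ_□(∂P∂* − ∂P_□∂*)h_□"*, the third line;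
*"ζ_□ ∈ C₀^∞(□̃)"*), p. 247 [PDF 25] ((2.134): *"ζ_□(y) − 1 = 0 for d(y, y′) ≦ M"*; Prop. 2.6 (2.136)), p. 238 [PDF 16] (*"we take the cube □̃³ and
identify it with a torus T_□"*), p. 231 [PDF 9] ((2.45)–(2.46)), p. 234 [PDF 12] (Lemma 2.1 (2.61)); T. Bałaban, *Regularity and decay of lattice Green's
functions*, Commun. Math. Phys. **89** (1983) 571–597 [Balaban1983RegularityDecay], §2 p. 577 (the product cut-offs `h_j` with `|∂h| ≤ O(M⁻¹)`).

CITATION HEADER (lean-in-tree rule) — WHAT IS REPRODUCED.  Phase-2 file of the `lit-balaban` typed skeleton (HOME `run/shared/lean/pub/lit-balaban/`), unit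
`lit-balaban-r03` (B6 fold owner; r03 gen 22), referee ref-4.  SKELETON rows **B6.Prop2.6** × **B6.Eq2.92** × **B6.Eq2.134** × B6.Eq2.46 × B6.Lem2.1 (cells;
decls of record untouched).  IMPORTS BY NAME, restating nothing: p22's `…B6Line3WindowV1` (**`line3_window`** — p38's size theorem
`B6DomainChangeP2134Sizes.line3P_hasMajorant_gk_zone_cut` with all analytic inputs discharged from the V1 data; `sandwich_transplant_eq`,
`onFun_dE_dsE_rescale`, `onFun_tsV1_P`), p22's `…B6MemberLevelsWindow` (`lam_tOf_sat`, `lev_famOf_tOf`, `card_bset_famOf_le`), `…B6GluedDistWindow`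
(`geomW`, `le_distW_of_far`, `FaceBlk`), `…B6ScalarAgreeV1Chart` (`transplant_GSG`), `…B6ScalarFactorsChartV1` (`GpV`, `SV`, `onFun_oneSubRE_eq`), r03's
`…B6Line3CutoffV1` (the cut-off `χ_c` and its dischargers), `…B6Line3GapV1` (`distT_far`, `abs_sub_ctr_le_of_mem_Qbig`), `…B6Line3ProfileV1`
(`profile_torus`, `budget_of_rate`, `CDgk_mono`, `CDgk_scale`, `poly_exp_absorb`), `…B6CubeWindowV1` (the window, `tC`, `PlC`, `Pl`, `hch`, `trV_hB`),
`…B6TranslateTorusV1` (`TB`, `mulOp_eq_conj`, `onFun_dgPart_eq_conj`, `hasMajorant_conj_chart`, `blkV1_translate`), `…B6Prop26KLevelAssemblyV1`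
(**`prop26_2136_kLevel_final_M`**, `hasMajorant_TB`, `hasMajorant_T_of_TB`), p38's `…B6Partition118KLevelTorusCentral` (`Dch`, `cc`, `QbigT`, `zetaT`).

## WHAT THIS FILE CERTIFIES (kernel-checked, 0 sorry, standard axioms; no `def … : Prop`, no new named fact)

* §1 the MEMBER FAMILY of the cube `□ = (j, β)`: `M′ := L^{a−1}` (`Mh1`), `P₁ := 2L^{j−j₀+1}` (`P1`), `D_□ := famOf M′ j₀ P₁ (2L) Λ′(□)` (`Dmem`) for the
  genuine member `t(□) = B6CubeWindowV1.tC` (scale `j₀`, period `2L·S_j`); its `line3_window` hypotheses `hN₁` (`hN1_cube`), the big alignment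
  `M′L^{j₀+2} ∣ x₀` (`hdivB_cube`), `hal_cube`, `hlevW_cube` (= p22's `lev_famOf_tOf`), `jlo_cube`;
* §2 the cut-offs in the chart frame `s_□`: `ζ^ch_□ := τ_v ζ_□` (`zch`), `h^ch_□ = B6CubeWindowV1.hch`; `|ζ^ch|, |h^ch| ≤ 1`; their blocks lie in `□̃ = Qbig`
  of the central cube (`blkS_mem_Qbig_of_zch/hch`), hence within `29S_j/16` of the centre coordinatewise (`abs_lab_sub_ctr_le`, `M_h ≥ 8`, `R ≥ 3L`);
* §3 the cut-off `χ_□ := χ_c(ctr, M_c)` of `B6Line3CutoffV1` at `M_c := 8S_j/3` (plateau `2S_j ⊇ □̃`, support `7S_j/3 < L·S_j/2 − 3`): the window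
  hypotheses `hlo_cube`, `hhi_cube`, `hwin_cube` (the `3L·S_j/2`-ball is two-level, blocks near `supp χ_□` have side `≤ L^{j+1} ≤ M_c`), `zone_nonempty`;
* §4 the DEPTH `M₀ = M_h/(4L)`: every block of `□̃` is `≥ M_h/(4L)` from every zone block of `χ_□` in the GLUED distance `d′` (`depth_cube`: the zone
  blocks and the face blocks of the window are `≥ 2S_j − 1` from the centre, `far_of_mem_zone`/`far_of_mem_face`; `le_distW_of_far` + `distT_far`);
* §5 the DIAMETER of `□̃`: `d_T(y, y′) ≤ (d+1)(4L²+1)·M_h` for blocks of `□̃` (`distT_le_of_mem_Qbig`: staircase bound `dist_blkOf_le_box` at level `j₀`);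
* §6 **`hasMajorant_cut_of_diam`** — from `d′` to `d_T` on cut-off sandwiches: a majorant `F(y)e^{−r d′}` of `ζ·X·h` on `geomW` gives `F(y)e^{ρΔ}e^{−ρ d_T}`
  on `geomTB` when the located pairs have `d_T ≤ Δ` (rows off `supp ζ`, columns off `supp h` vanish; `F ≥ 0` is read off the majorant at `μ = 0`);
* §7 the OPERATORS: `target_eq_conj` (`ζ_□(∂(1−R)∂* − P_□)h_□ = τ_{−v}(ζ^ch(∂(1−R^ch)∂* − P^ch_□)h^ch)τ_v`) and **`chart_eq_line3`** (the chart-frame operator IS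
  `line3_window`'s `ζ(∂(G′SG′ − G̃′_□S̃_□G̃′_□)∂*)h`: `onFun_oneSubRE_eq`; `P^ch_□ = ε_B(∂_□P_□∂*_□)ρ_B` with the unit `s(□) = (c_f/L^{j₀})²` absorbed by
  `onFun_dE_dsE_rescale`; `sandwich_transplant_eq`; `P_□ = G′_□S_□G′_□` by `onFun_tsV1_P` + `lam_tOf_sat`; `transplant_GSG`);
* §8 **`line3_cube`** — LINE 3 OF (2.92) FOR THE GENUINE MEMBER OF EVERY CUBE, the last displayed analytic hypothesis (iv) of
  `B6Prop26KLevelAssemblyV1.prop26_2136_kLevel_final_M` (and of p38's `…PerCube.prop26_2136_kLevel_assembly_line3`): `∃ ρ₃ > 0, C_D ≥ 0, c_D > 0, M₃` (on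
  `d, L` and the constants `M₁, δ, C` of `line3_window`) with, for every V1 global torus (`k ≥ 2`, `M_h = L^a`, `M₃ ≤ L·M_h`, `R ≥ 2L²`, `P′ ≥ 5`, `L ≥ 5`,
  cubes placed), every `c_f ≠ 0`, all weights `w`, every cube `□`:
  `HasMajorant (geomTB D) (blkV1 hN D) (ζ_□(∂(1−R)∂* − P_□)h_□) (C_D c_f² e^{−c_D LM_h}/len(y)²·e^{−ρ₃ d_T(y,y″)})` — `line3_window` in the chart frame with
  §§1–4, `κ = δ/8`, the torus profile of Lemma 2.1 (`profile_torus`, exponent `N₃` by `budget_of_rate`); the member block count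
  `|𝔅(T_□)| ≤ A₁M_h^{d+1}` (`card_bset_famOf_le`) and `e^{ρ₃Δ}` absorbed into `e^{−(δ−2κ)M₀/96} = e^{−c₁M_h}` (`absorb`, `CDgk_mono/scale`); §§5–7; the
  block-map transport `hasMajorant_conj_chart`;
  **`prop26_2136_kLevel_unconditional`** — PROPOSITION 2.6 (2.136)₁ AT k LEVELS FOR THE GENUINE `G = GE (domT hN D hk)`: for every weight band
  `[b₀, b₁]` there is `σ₁ > 0` such that for all `0 < σ ≤ σ₁`, `0 < α ≤ 1` there are `A ≥ 0`, `M₂ > 0` with, for every V1 global torus with `k ≥ 2`,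
  `M_h = L^a ≥ 8`, `M₂ ≤ L·M_h`, `R ≥ 2L²`, `P′ ≥ 5`, `L ≥ 5`, cubes placed, `c_f ≠ 0`, positive weights in the band (2.16):
  `HasMajorant (geomT D) (blkV1 hN D) G (A·(L^{j(y)}/c_f)²·e^{−δ₃(α,2σ) d_T(y,y′)})` — `prop26_2136_kLevel_final_M` at `σ ≤ min(σ₀, ρ₃/2)` with its
  hypothesis (iv) fed by `line3_cube` (rate weakened by monotonicity).  NO analytic hypothesis of the k-level (2.136)₁ remains displayed.
  v1.1: **`prop26_2136_kLevel_unconditional_L5`** — the same at `L = 5` (`ℓ = 4`), `P′_μ ≥ 12`, where the canonical chart places every cube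
  (`B6CubeWindowV1.placed_all_cubes`): the `Placed` hypothesis DISCHARGED (for every odd `L ≥ 5` without placement use p38's padded twin
  `B6Prop26KLevelAssemblyPadV1.prop26_2136_kLevel_final_pad_M` fed with `line3_cube` at the padded family).

## HONEST SCOPE / DIVERGENCES

(1) Print proves line 3 by the domain-change estimate (2.134) with a cut-off `ζ_□` and *"ζ_□(y) − 1 = 0 for d(y, y′) ≦ M"*; the concrete cut-off
`χ_c(ctr, 8S_j/3)` (a product of the `C^∞` plateaus of [Balaban1983RegularityDecay] §2), the depth `M_h/(4L)`, the diameter `(d+1)(4L²+1)M_h`, the rates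
`κ = δ/8`, `ρ₃ = c₁/(4c_Δ)`, `c_D = c₁/(2L)` (`c₁ = (δ − 2κ)/(384L)`) and the constant `C_D = C_D^{gk}(L³, C, C, (d+1)C, θ, Θ₂, K₃)·(1+A₁)⁶(6(d+1))!/(c₁/4)^{6(d+1)}`
are OUR bookkeeping for the quarter-point window of ROUTE V; only their existence is asserted in the statements.  (2) The remaining hypotheses of
`prop26_2136_kLevel_unconditional` are print's SETTING, not analytic inputs: (2.2) `M` large (`M₂ ≤ L·M_h`, `M_h = L^a ≥ 8`) and `R ≥ 2L²`; (2.16) the weight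
band `GlobalBand b₀ b₁ c_f w`; the V1 torus with `k ≥ 2` (`k = 1` is [Balaban1984PropagatorsI]), `P′_μ ≥ 5`, `L ≥ 5`; the placement of the top cubes
(`Placed`, automatic at `L = 5`, `P′ ≥ 12`: `B6CubeWindowV1.placed_all_cubes`).  (3) Distance (2.46) in p21's reading R2 (touching blocks; G-B6-22); integer
torus, lattice units; entries (2.136)₂₋₄ / (2.137)–(2.140) untouched; nothing on d = 4 or the continuum; NOT summit progress.  (4) Definitions with bodies
only (`Mh1`, `P1`, `Dmem`, `zch`, `Mc`, `chiC`, `cLC`); no `def … : Prop`; standard axioms.  v1.0 p366020; v1.1 adds `prop26_2136_kLevel_unconditional_L5`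
(theorem only).  Unit `lit-balaban-r03` (gen 22), 2026-08-23.
-/

noncomputable section

open scoped BigOperators
open Finset

namespace Literature.MathematicalPhysics.QuantumFieldTheory.Balaban1983to89.B6Line3CubeV1

open LatticeFieldCalculus
open B4Reflection242 (boxDom mem_boxDom blk)
open B4ContourShift (supNorm)
open B6MultiLevelBoxOperator (N0 bigSide one_le_bigSide Domains)
open B6MultiLevelTorusOperator (TDomains N0_eq_bigSide_mul)
open B6Eq238MultiLevelTorus (svec)
open B6Cover236MultiLevelBlocks (cubes ctr side Q)
open B6Geom246MultiLevelBox (bset blkOf blkOf_val toR supNorm_eq_dist exists_blkOf_eq dist_blkOf_le_box lev_eq_of_blkOf_eq bond)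
open B6Geom246MultiLevelTorus (geomT bondT blkMap blkMap_injective distT_le_dist_box)
open B6TorusDepthDistance (distT_chart_eq)
open B8Ineq192MultiLevelTorus (geomTB geomTB_len geomTB_M geomTB_dist geomTB_RM)
open B6Partition118KLevelTorusCentral (Dch cc side_cc ctr_cc_bounds QbigT zetaT zetaT_nonneg zetaT_le_one one_le_of_four_le)
open B6Partition118KLevelFineLip (Qbig mem_Qbig Q_subset_Qbig)
open B6Partition118KLevelFine (hF blkOf_mem_Q_of_hF_ne_zero)
open B6GlobalChartV1 (PV toBox toBox_apply toBox_surjective domT blkV1)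
open B6ScalarFactorsChartV1 (blkS blkV1_eq_blkS GpV SV onFun_oneSubRE_eq)
open B6AgreeLapV1Chart (eS eB DeepS DeepB deepS_mono cS cB mem_cB_W onFun_comp transplant_eB_eq posV)
open B6Prop25TwoScaleCensus (TSIdx)
open B6MemberOfCubeV1 (bare tOf)
open B6MemberTorusTDomainsV1 (famOf j_le_lev bigLab)
open B6MemberLevelsWindow (lam_tOf_sat lev_famOf_tOf card_bset_famOf_le)
open B6GluedDistWindow (geomW geomW_len geomW_dist FaceBlk le_distW_of_far distW_nonneg)
open B6RandomWalk (HasMajorant hasMajorant_mono BlockSupp delta3)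
open B6Prop26Gluing (mulOp mulOp_apply)
open B6Prop26ReachTransplant (transplant transplant_smul chartBond)
open B6Ineq2133TwoScaleV1 (onFun onFun_apply)
open B6SectAOperatorsV1 (dE dsE RE BondIdx)
open B6SectAVectorModelV1 (GE)
open B6TranslateV1 (tv trV trV_apply)
open B6TranslateTorusV1 (vch TB TB_mul_TB_neg mulOp_eq_conj hasMajorant_conj_chart onFun_dgPart_eq_conj blkV1_translate blkMap_fst)
open B6Prop26KLevelSkeletonV1 (hB zB zB_apply hB_apply abs_hB_le_one pref)
open B6CubeWindowV1 (eC pow_eC x0 x0_eq_ctr_sub pow_dvd_x0 bigSide_dvd_x0 j0 one_le_j0 j0_succ_le j0_hj j0_le_level two_level rho hlev_deep hch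
  hch_apply Placed hx0 hfit tC tC_j sc PlC wC trV_hB Pl GlobalBand band_le one_le_of_eight_le four_le_of_five_le one_le_bigSide_real)
open B6CubeInDecayV1 (conj_mul)
open B6Line3WindowV1 (line3_window sandwich_transplant_eq onFun_dE_dsE_rescale onFun_tsV1_P)
open B6Line3CutoffV1 (chiS lab lab_eq_toR NearS nearS_mono cL zoneN chiS_nonneg chiS_le_one deep_of_near shift_near chiS_deep chiS_jump hd1_chiS
  hd1'_chiS hd2_chiS hdb_chiS D1_thetaProf_nonneg D2_thetaProf_nonneg chi_eq_one_of_not_mem_zoneN chi_const_of_not_mem_zoneN zoneN_nonempty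
  cL_mul_chiS hEL_cL exists_far_of_mem_zoneN chiS_ne_one_of_corner)
open B6Line3GapV1 (abs_sub_ctr_le_of_mem_Qbig distT_far)
open B6Line3ProfileV1 (budget_of_rate profile_torus CDgk_mono CDgk_scale poly_exp_absorb)
open B6DomainChangeP2134Sizes (CDgk CDgk_nonneg)
open B6Ineq261LevelGap (K261 K261_nonneg)
open B6DomainChange (Profile)
open B4PartitionUnity22 (thetaProf D1 D2)
open B6Prop26KLevelAssemblyV1 (hasMajorant_TB hasMajorant_T_of_TB prop26_2136_kLevel_final_M)

variable {d ℓ : ℕ} {hd : 1 ≤ d + 1} {hL : Odd (ℓ + 1) ∧ 1 < ℓ + 1} {a₀ a₁ : ℝ} {m K : ℕ} {Mh k R : ℕ} {P' : Fin (d + 1) → ℕ}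

/-! ## §1  The member family `D_□` of the cube: `M′ = L^{a−1}`, `k₁ = j₀ + 1`, `P₁ = 2L^{j−j₀+1}`, `R₁ = 2L`; its hypotheses for `line3_window` -/

section Member

variable (hN : ∀ μ, N0 ℓ Mh k P' μ = (PV d ℓ m K hd hL).sitesPerDir 0) {D : TDomains d ℓ Mh k P' R} (hk : k ≤ m + K)
  (hMh1 : 1 ≤ Mh) (hP4 : ∀ μ, 4 ≤ P' μ) {a : ℕ} (hMha : Mh = (ℓ + 1) ^ a) (c : ↥(cubes D.toDomains)) (ha : a₀ ≤ a₁)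

/-- **THE BIG-BLOCK MULTIPLICITY `M′ := L^{a−1} = M_h/L` OF THE MEMBER TORUS** (`M_h = L^a`; the member's big blocks have side `M′·L^{j₀+2} =
M_h·L^{j₀+1}`). [cite: Balaban1984PropagatorsII, (2.89) p.239, p.238 (T_□), dictionary] -/
def Mh1 (ℓ a : ℕ) : ℕ := (ℓ + 1) ^ (a - 1)

/-- **THE BOX MULTIPLICITIES `P₁ μ := 2L^{j−j₀+1}` OF THE MEMBER TORUS** (so that `M′·L^{j₀+2}·P₁ = 2L·S_j`, the member period).
[cite: Balaban1984PropagatorsII, p.238 (T_□ = □̃³), dictionary] -/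
def P1 (c : ↥(cubes D.toDomains)) : Fin (d + 1) → ℕ := fun _ => 2 * (ℓ + 1) ^ (c.1.1 - j0 hMh1 hP4 c + 1)

omit hN hk in
include hMha in
/-- `a ≥ 1` when `M_h = L^a ≥ 8`. [cite: Balaban1984PropagatorsII, (2.2) p.224, bookkeeping] -/
theorem one_le_expo (hM8 : 8 ≤ Mh) : 1 ≤ a := by
  by_contra h
  have h0 : a = 0 := by omega
  rw [h0, pow_zero] at hMha
  omega

omit hN hk in
include hMha in
/-- `L·M′ = M_h`. [cite: Balaban1984PropagatorsII, p.238, bookkeeping] -/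
theorem L_mul_Mh1 (hM8 : 8 ≤ Mh) : (ℓ + 1) * Mh1 ℓ a = Mh := by
  have h1 := one_le_expo hMha hM8
  unfold Mh1
  rw [hMha, ← pow_succ']
  congr 1; omega

omit hN hk in
include hMha in
/-- `M′ ∣ M_h`. [cite: Balaban1984PropagatorsII, (2.1) p.224, bookkeeping] -/
theorem Mh1_dvd (hM8 : 8 ≤ Mh) : Mh1 ℓ a ∣ Mh := ⟨ℓ + 1, by rw [mul_comm]; exact (L_mul_Mh1 hMha hM8).symm⟩

omit hN hk in
/-- `M′ ≥ 1`. [cite: Balaban1984PropagatorsII, (2.1) p.224, bookkeeping] -/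
theorem one_le_Mh1 : 1 ≤ Mh1 ℓ a := Nat.one_le_pow _ _ (Nat.succ_pos ℓ)

omit hN hk in
/-- `P₁ μ ≥ 4`. [cite: Balaban1984PropagatorsII, p.238, bookkeeping] -/
theorem four_le_P1 (hℓ : 1 ≤ ℓ) (μ : Fin (d + 1)) : 4 ≤ P1 hMh1 hP4 c μ := by
  unfold P1
  have : (ℓ + 1) ^ 1 ≤ (ℓ + 1) ^ (c.1.1 - j0 hMh1 hP4 c + 1) := Nat.pow_le_pow_right (Nat.succ_pos ℓ) (by omega)
  have h2 : 2 ≤ (ℓ + 1) ^ 1 := by rw [pow_one]; omega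
  omega

include hMha in
/-- the fine period of the member torus: `2L·S_j`. [cite: Balaban1984PropagatorsII, p.238 (T_□ = □̃³), bookkeeping] -/
theorem tC_sites (wc : BondIdx (domT hN (D.chart (svec ℓ k c.1.1 c.1.2)) hk) → ℝ) (cf : ℝ) :
    ((tC hN hk hMh1 hP4 c ha a wc cf).P.sitesPerDir 0 : ℕ) = 2 * ((ℓ + 1) * bigSide ℓ Mh c.1.1) := by
  rw [← pow_eC hMha]
  show 2 * (ℓ + 1) ^ (eC a c.1.1 + 0 - 0) = _
  simp

include hMha in
/-- the member period fits above the window corner (`B6CubeWindowV1.hfit`, typed with the genuine member `t(□)`).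
[cite: Balaban1984PropagatorsII, p.238, bookkeeping] -/
theorem hfitC (hpl : Placed ℓ k P' c.1) (wc : BondIdx (domT hN (D.chart (svec ℓ k c.1.1 c.1.2)) hk) → ℝ) (cf : ℝ) :
    ∀ μ, x0 ℓ Mh k c.1 μ + ((tC hN hk hMh1 hP4 c ha a wc cf).P.sitesPerDir 0 : ℕ) ≤ ((PV d ℓ m K hd hL).sitesPerDir 0 : ℕ) :=
  hfit hN hMh1 hP4 hMha c ha hpl

include hMha in
/-- **`hN₁` OF THE MEMBER FAMILY**: `M′·L^{j₀+2}·P₁ = 2L^{a+j+2}`, the fine period of `T_□` (`j₀ ≤ j`, `a ≥ 1`).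
[cite: Balaban1984PropagatorsII, (2.89) p.239, p.238, bookkeeping] -/
theorem hN1_cube (hM8 : 8 ≤ Mh) (hR2 : 2 * (ℓ + 1) ^ 2 ≤ R) (wc : BondIdx (domT hN (D.chart (svec ℓ k c.1.1 c.1.2)) hk) → ℝ) (cf : ℝ) :
    ∀ μ, N0 ℓ (Mh1 ℓ a) (j0 hMh1 hP4 c + 1) (P1 hMh1 hP4 c) μ =
      (PV d ℓ (tC hN hk hMh1 hP4 c ha a wc cf).m (tC hN hk hMh1 hP4 c ha a wc cf).K hd hL).sitesPerDir 0 := by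
  intro μ
  have hj := (j0_le_level hMh1 hP4 c hL hR2).1
  have key := L_mul_Mh1 hMha hM8
  have e : (PV d ℓ (tC hN hk hMh1 hP4 c ha a wc cf).m (tC hN hk hMh1 hP4 c ha a wc cf).K hd hL).sitesPerDir 0 =
      ((tC hN hk hMh1 hP4 c ha a wc cf).P.sitesPerDir 0 : ℕ) := rfl
  rw [e, tC_sites hN hk hMh1 hP4 hMha c ha, N0_eq_bigSide_mul]
  have eM : Mh * (ℓ + 1) ^ (c.1.1 + 1) = (ℓ + 1) * Mh1 ℓ a * (ℓ + 1) ^ (c.1.1 + 1) := by rw [key]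
  unfold P1 bigSide
  rw [eM]
  obtain ⟨s, hs⟩ := Nat.exists_eq_add_of_le hj
  have e3 : c.1.1 - j0 hMh1 hP4 c = s := by omega
  rw [e3, hs]
  ring

omit hN hk in
include hMha in
/-- **THE BIG ALIGNMENT OF THE WINDOW CORNER**: `M′·L^{j₀+2} ∣ x₀(□)_μ` (`x₀ = S_j·(q − ℓ/2)`, `S_j = L^{a+j+1}`, `j₀ ≤ j`).
[cite: Balaban1984PropagatorsII, p.238, (2.1) p.224, bookkeeping] -/
theorem hdivB_cube (hL : Odd (ℓ + 1) ∧ 1 < ℓ + 1) (hM8 : 8 ≤ Mh) (hR2 : 2 * (ℓ + 1) ^ 2 ≤ R) (μ : Fin (d + 1)) :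
    ((((ℓ + 1) ^ (j0 hMh1 hP4 c + 1) * (Mh1 ℓ a * (ℓ + 1)) : ℕ) : ℤ)) ∣ x0 ℓ Mh k c.1 μ := by
  refine dvd_trans ?_ (bigSide_dvd_x0 ℓ Mh k c.1 μ)
  have hj := (j0_le_level hMh1 hP4 c hL hR2).1
  have key := L_mul_Mh1 hMha hM8
  refine Int.natCast_dvd_natCast.2 ?_
  have eM : bigSide ℓ Mh c.1.1 = (ℓ + 1) * Mh1 ℓ a * (ℓ + 1) ^ (c.1.1 + 1) := by rw [key]; rfl
  rw [eM]
  obtain ⟨s, hs⟩ := Nat.exists_eq_add_of_le hj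
  refine ⟨(ℓ + 1) ^ s, ?_⟩
  rw [hs]
  ring

omit hN hk in
/-- `L^{j₀+1} ∣ x₀(□)_μ` (`hal` of `line3_window` with `k₁ = j₀ + 1`). [cite: Balaban1984PropagatorsII, p.238, bookkeeping] -/
theorem hal_cube (hL : Odd (ℓ + 1) ∧ 1 < ℓ + 1) (hR2 : 2 * (ℓ + 1) ^ 2 ≤ R) (μ : Fin (d + 1)) : ((((ℓ + 1) ^ (j0 hMh1 hP4 c + 1) : ℕ) : ℤ)) ∣ x0 ℓ Mh k c.1 μ :=
  pow_dvd_x0 ℓ Mh k c.1 (by have := (j0_le_level hMh1 hP4 c hL hR2).1; omega) μ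

/-- **THE MEMBER FAMILY `D_□ := famOf M′ j₀ P₁ (2L) Λ′(□)`** of the genuine member `t(□)` (levels `j₀` off and `j₀ + 1` on `B^{j₀}(Λ′(□))`).
[cite: Balaban1984PropagatorsII, (2.89)–(2.90) p.239] -/
abbrev Dmem (hk2 : 2 ≤ k) (a : ℕ) (wc : BondIdx (domT hN (D.chart (svec ℓ k c.1.1 c.1.2)) hk) → ℝ) (cf : ℝ) :
    TDomains d ℓ (Mh1 ℓ a) (j0 hMh1 hP4 c + 1) (P1 hMh1 hP4 c) (2 * (ℓ + 1)) :=
  famOf (Mh1 ℓ a) (j0 hMh1 hP4 c) (P1 hMh1 hP4 c) (2 * (ℓ + 1)) (one_le_j0 hMh1 hP4 c hk2) (tC hN hk hMh1 hP4 c ha a wc cf).Λ'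

include hMha in
/-- **`hlevW` FOR THE CUBE**: the member levels are the chart levels through the window (`B6MemberLevelsWindow.lev_famOf_tOf` with this file's data).
[cite: Balaban1984PropagatorsII, (2.89)–(2.90) p.239, p.238] -/
theorem hlevW_cube (hk2 : 2 ≤ k) (hM8 : 8 ≤ Mh) (hR2 : 2 * (ℓ + 1) ^ 2 ≤ R) (hpl : Placed ℓ k P' c.1)
    (wc : BondIdx (domT hN (D.chart (svec ℓ k c.1.1 c.1.2)) hk) → ℝ) (cf : ℝ) :
    ∀ x ∈ DeepS (tC hN hk hMh1 hP4 c ha a wc cf) (x0 ℓ Mh k c.1) 0,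
      (Dmem hN hk hMh1 hP4 c ha hk2 a wc cf).lev
          (toBox (hN1_cube hN hk hMh1 hP4 hMha c ha hM8 hR2 wc cf) (eS (tC hN hk hMh1 hP4 c ha a wc cf) (x0 ℓ Mh k c.1) x) :
            Fin (d + 1) → ℤ) =
        (D.chart (svec ℓ k c.1.1 c.1.2)).lev (toBox hN x) := by
  intro x hx
  have hk1 : 1 ≤ k := by omega
  exact lev_famOf_tOf (j0_succ_le hMh1 hP4 c hk1) (hx0 hpl) (hfitC hN hk hMh1 hP4 hMha c ha hpl wc cf) (hdivB_cube hMh1 hP4 hMha c hL hM8 hR2)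
    (Mh1_dvd hMha hM8) one_le_Mh1 (one_le_j0 hMh1 hP4 c hk2) (hN1_cube hN hk hMh1 hP4 hMha c ha hM8 hR2 wc cf)
    (hlev_deep hN hMh1 hP4 hMha c ha hR2) hx

omit hN hk in
/-- `hlo` of `line3_window`: every member site has level `≥ j₀`. [cite: Balaban1984PropagatorsII, (2.89) p.239, bookkeeping] -/
theorem jlo_cube {hj : 1 ≤ j0 hMh1 hP4 c} {Λ' : Finset (Site (PV d ℓ (eC a c.1.1) 0 hd hL) (j0 hMh1 hP4 c + 1))}
    (z : ↥(boxDom (N0 ℓ (Mh1 ℓ a) (j0 hMh1 hP4 c + 1) (P1 hMh1 hP4 c)))) :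
    j0 hMh1 hP4 c ≤ (famOf (Mh1 ℓ a) (j0 hMh1 hP4 c) (P1 hMh1 hP4 c) (2 * (ℓ + 1)) hj Λ').lev z.1 :=
  j_le_lev _ _ z.1

end Member

/-! ## §2  The cut-offs of the cube in the chart frame: `ζ^ch_□ = τ_v ζ_□`, `h^ch_□`; their blocks lie in `□̃`, within `29S/16` of the centre -/

section Cutoffs

variable (hN : ∀ μ, N0 ℓ Mh k P' μ = (PV d ℓ m K hd hL).sitesPerDir 0) {D : TDomains d ℓ Mh k P' R} (hk : k ≤ m + K)
  (hMh1 : 1 ≤ Mh) (hP4 : ∀ μ, 4 ≤ P' μ) {a : ℕ} (hMha : Mh = (ℓ + 1) ^ a) (c : ↥(cubes D.toDomains)) (ha : a₀ ≤ a₁)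

/-- **`ζ_□` IN THE CHART FRAME**: the skeleton's `ζ_□ = zB` translated by the chart vector. [cite: Balaban1984PropagatorsII, (2.91) p.239 («ζ_□»), dictionary (charts)] -/
abbrev zch (c : ↥(cubes D.toDomains)) : PBond (PV d ℓ m K hd hL) 0 → ℝ :=
  trV (vch Mh k (svec ℓ k c.1.1 c.1.2)) (zB hN D hMh1 hP4 c)

/-- `0 ≤ ζ^ch ≤ 1`. [cite: Balaban1984PropagatorsII, p.239, bookkeeping] -/
theorem abs_zch_le_one (b : PBond (PV d ℓ m K hd hL) 0) : |zch hN hMh1 hP4 c b| ≤ 1 := by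
  dsimp only [zch]
  rw [trV_apply, zB_apply]
  exact abs_le.2 ⟨by linarith [zetaT_nonneg hMh1 hP4 c (toBox hN (b.translate (vch Mh k (svec ℓ k c.1.1 c.1.2))).src)],
    zetaT_le_one hMh1 hP4 c _⟩

/-- `|h^ch| ≤ 1`. [cite: Balaban1984PropagatorsII, (2.36) p.229, bookkeeping] -/
theorem abs_hch_le_one (b : PBond (PV d ℓ m K hd hL) 0) : |hch hN hMh1 hP4 c b| ≤ 1 := by
  rw [← trV_hB, trV_apply]
  exact abs_hB_le_one hN D hMh1 (one_le_of_four_le hP4) c _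

/-- **THE BLOCKS OF `supp ζ^ch_□` LIE IN `□̃ = Qbig` OF THE CENTRAL CUBE** (the block map of the chart is injective).
[cite: Balaban1984PropagatorsII, p.239 («ζ_□ ∈ C₀^∞(□̃)»), dictionary (charts)] -/
theorem blkS_mem_Qbig_of_zch {b : PBond (PV d ℓ m K hd hL) 0} (hb : zch hN hMh1 hP4 c b ≠ 0) :
    blkS hN (D.chart (svec ℓ k c.1.1 c.1.2)) b.src ∈ Qbig (Dch D c) (cc D hMh1 hP4 c) := by
  have hP := one_le_of_four_le hP4
  dsimp only [zch] at hb
  rw [trV_apply, zB_apply] at hb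
  by_cases hmem : blkOf D.toDomains (toBox hN (b.translate (vch Mh k (svec ℓ k c.1.1 c.1.2))).src) ∈ QbigT D hMh1 hP4 c
  · unfold QbigT at hmem
    obtain ⟨y, hy, hyeq⟩ := Finset.mem_image.1 hmem
    have e : blkOf D.toDomains (toBox hN (b.translate (vch Mh k (svec ℓ k c.1.1 c.1.2))).src) =
        blkMap D (svec ℓ k c.1.1 c.1.2) (blkS hN (D.chart (svec ℓ k c.1.1 c.1.2)) b.src) :=
      blkV1_translate hN D hMh1 hP (svec ℓ k c.1.1 c.1.2) b
    rw [e] at hyeq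
    rwa [← blkMap_injective hMh1 hP _ hyeq]
  · exact absurd (by unfold zetaT; rw [if_neg hmem]) hb

/-- **THE BLOCKS OF `supp h^ch_□` LIE IN `□̃`** (`supp h_□ ⊂ □⁺ ⊂ □̃`; `M_h ≥ 2`, `R ≥ 2L`). [cite: Balaban1984PropagatorsII, p.235, (2.36) p.229] -/
theorem blkS_mem_Qbig_of_hch (hM2 : 2 ≤ Mh) (hR : 2 * (ℓ + 1) ≤ R) {b : PBond (PV d ℓ m K hd hL) 0} (hb : hch hN hMh1 hP4 c b ≠ 0) :
    blkS hN (D.chart (svec ℓ k c.1.1 c.1.2)) b.src ∈ Qbig (Dch D c) (cc D hMh1 hP4 c) :=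
  Q_subset_Qbig _ hMh1 _ (blkOf_mem_Q_of_hF_ne_zero _ hM2 hR hb)

/-- **THE SITES OF A BLOCK OF `□̃` ARE WITHIN `29S_j/16` OF THE CENTRE, COORDINATEWISE** (`M_h ≥ 8`, `R ≥ 3L`).
[cite: Balaban1984PropagatorsII, p.239 («□̃»), p.235, (2.2) p.224] -/
theorem abs_lab_sub_ctr_le (hM8 : 8 ≤ Mh) (hR : 3 * (ℓ + 1) ≤ R) {x : Site (PV d ℓ m K hd hL) 0}
    (hx : blkS hN (D.chart (svec ℓ k c.1.1 c.1.2)) x ∈ Qbig (Dch D c) (cc D hMh1 hP4 c)) (μ : Fin (d + 1)) :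
    |lab x μ - ctr (Dch D c) (cc D hMh1 hP4 c) μ| ≤ 29 / 16 * (bigSide ℓ Mh c.1.1 : ℝ) := by
  have h := abs_sub_ctr_le_of_mem_Qbig (Dch D c) hM8 hR hx (x := toBox hN x) rfl μ
  rw [side_cc] at h
  rw [lab_eq_toR hN]
  linarith

end Cutoffs

/-! ## §3  The cut-off `χ_□ := χ_c(ctr, 8S_j/3)` of the cube and its window hypotheses -/

section Chi

variable (hN : ∀ μ, N0 ℓ Mh k P' μ = (PV d ℓ m K hd hL).sitesPerDir 0) {D : TDomains d ℓ Mh k P' R} (hk : k ≤ m + K)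
  (hMh1 : 1 ≤ Mh) (hP4 : ∀ μ, 4 ≤ P' μ) {a : ℕ} (hMha : Mh = (ℓ + 1) ^ a) (c : ↥(cubes D.toDomains)) (ha : a₀ ≤ a₁)

/-- **THE SCALE `M_c := 8S_j/3` OF `χ_□`** (plateau radius `¾M_c = 2S_j ⊇ □̃ + S_j/8`, support radius `⅞M_c = 7S_j/3 < L·S_j/2 − 3`).
[cite: Balaban1984PropagatorsII, p.238 (□̃ ⊂ □̃² ⊂ □̃³); Balaban1983RegularityDecay, §2 p.577; constants ours] -/
def Mc (ℓ Mh j : ℕ) : ℝ := 8 / 3 * (bigSide ℓ Mh j : ℝ)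

/-- **`χ_□`**: the product cut-off `χ_c` centred at the centre of the central cube, at scale `M_c`. [cite: Balaban1984PropagatorsII, p.238 (the domain
change of line 3 of (2.92)); Balaban1983RegularityDecay, §2 p.577] -/
abbrev chiC (c : ↥(cubes D.toDomains)) : Site (PV d ℓ m K hd hL) 0 → ℝ := chiS (ctr (Dch D c) (cc D hMh1 hP4 c)) (Mc ℓ Mh c.1.1)

/-- **`c_L`** of the cube: the indicator of the plateau `{|x − ctr|_∞ ≤ 2S_j}`. [cite: Balaban1984PropagatorsII, p.238, bookkeeping] -/
abbrev cLC (c : ↥(cubes D.toDomains)) : Site (PV d ℓ m K hd hL) 0 → ℝ := cL (ctr (Dch D c) (cc D hMh1 hP4 c)) (Mc ℓ Mh c.1.1)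

omit hMh1 in
/-- `S_j ≥ M_h·L` (real). [cite: Balaban1984PropagatorsII, (2.1) p.224, bookkeeping] -/
theorem Mh_le_bigSide (j : ℕ) : (Mh : ℝ) * ((ℓ : ℝ) + 1) ≤ (bigSide ℓ Mh j : ℝ) := by
  unfold bigSide; push_cast
  have hL1 : (1 : ℝ) ≤ (ℓ : ℝ) + 1 := by linarith [(Nat.cast_nonneg ℓ : (0 : ℝ) ≤ ℓ)]
  have h1 : ((ℓ : ℝ) + 1) ^ 1 ≤ ((ℓ : ℝ) + 1) ^ (j + 1) := pow_le_pow_right₀ hL1 (by omega)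
  rw [pow_one] at h1
  have hM : (0 : ℝ) ≤ Mh := Nat.cast_nonneg _
  nlinarith

/-- `M_c > 0`. [cite: Balaban1984PropagatorsII, p.238, bookkeeping] -/
theorem Mc_pos (hMh1 : 1 ≤ Mh) (j : ℕ) : 0 < Mc ℓ Mh j := by
  unfold Mc; have := one_le_bigSide_real (ℓ := ℓ) hMh1 j; positivity

/-- **`hlo` OF THE CUBE**: `x₀ + ⅞M_c + 3 ≤ ctr` (`x₀ = ctr − L·S_j/2`, `L ≥ 5`, `S_j ≥ 18`). [cite: Balaban1984PropagatorsII, p.238, bookkeeping] -/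
theorem hlo_cube (hL : Odd (ℓ + 1) ∧ 1 < ℓ + 1) (hℓ : 4 ≤ ℓ) (hM8 : 8 ≤ Mh) (μ : Fin (d + 1)) :
    (x0 ℓ Mh k c.1 μ : ℝ) + (7 / 8 * Mc ℓ Mh c.1.1 + 3) ≤ ctr (Dch D c) (cc D hMh1 hP4 c) μ := by
  rw [x0_eq_ctr_sub hL hMh1 hP4 c μ]
  unfold Mc
  have hS := Mh_le_bigSide (ℓ := ℓ) (Mh := Mh) c.1.1
  have hM : (8 : ℝ) ≤ Mh := by exact_mod_cast hM8
  have hl : (4 : ℝ) ≤ ℓ := by exact_mod_cast hℓ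
  have hS0 : (0 : ℝ) ≤ (bigSide ℓ Mh c.1.1 : ℝ) := by positivity
  have h40 : (40 : ℝ) ≤ (bigSide ℓ Mh c.1.1 : ℝ) := by nlinarith
  nlinarith [mul_nonneg (sub_nonneg.2 hl) hS0]

include hMha in
/-- **`hhi` OF THE CUBE**: `ctr + ⅞M_c + 3 ≤ x₀ + 2L·S_j`. [cite: Balaban1984PropagatorsII, p.238, bookkeeping] -/
theorem hhi_cube (hM8 : 8 ≤ Mh) (wc : BondIdx (domT hN (D.chart (svec ℓ k c.1.1 c.1.2)) hk) → ℝ) (cf : ℝ) (μ : Fin (d + 1)) :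
    ctr (Dch D c) (cc D hMh1 hP4 c) μ + (7 / 8 * Mc ℓ Mh c.1.1 + 3) ≤
      (x0 ℓ Mh k c.1 μ : ℝ) + ((tC hN hk hMh1 hP4 c ha a wc cf).P.sitesPerDir 0 : ℕ) := by
  rw [tC_sites hN hk hMh1 hP4 hMha c ha, x0_eq_ctr_sub hL hMh1 hP4 c μ]
  unfold Mc
  have hS := Mh_le_bigSide (ℓ := ℓ) (Mh := Mh) c.1.1
  have hM : (8 : ℝ) ≤ Mh := by exact_mod_cast hM8
  have hl : (1 : ℝ) ≤ ℓ := by exact_mod_cast (by have := hL.2; omega : 1 ≤ ℓ)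
  have hS0 : (0 : ℝ) ≤ (bigSide ℓ Mh c.1.1 : ℝ) := by positivity
  have h16 : (16 : ℝ) ≤ (bigSide ℓ Mh c.1.1 : ℝ) := by nlinarith
  push_cast
  nlinarith [mul_nonneg (sub_nonneg.2 hl) hS0]

/-- the length of the block of a site is `L^{lev}`. [cite: Balaban1984PropagatorsII, (2.1) p.224, dictionary] -/
theorem len_blkS (D' : TDomains d ℓ Mh k P' R) (x : Site (PV d ℓ m K hd hL) 0) :
    (geomTB D').len (blkS hN D' x) = ((ℓ : ℝ) + 1) ^ D'.lev (toBox hN x) := by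
  rw [geomTB_len, mul_one]; rfl

/-- **`hwin` OF THE CUBE**: the blocks of the sites near the support of `χ_□` have side `≤ L^{j₀+1} ≤ M_c` (the `3L·S_j/2`-ball is two-level).
[cite: Balaban1984PropagatorsII, (2.2) p.224, p.238] -/
theorem hwin_cube (hM8 : 8 ≤ Mh) (hR2 : 2 * (ℓ + 1) ^ 2 ≤ R) :
    ∀ x : Site (PV d ℓ m K hd hL) 0, NearS (ctr (Dch D c) (cc D hMh1 hP4 c)) (Mc ℓ Mh c.1.1) 3 x →
      (geomTB (D.chart (svec ℓ k c.1.1 c.1.2))).len (blkS hN (D.chart (svec ℓ k c.1.1 c.1.2)) x) ≤ Mc ℓ Mh c.1.1 := by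
  intro x hx
  have hS := one_le_bigSide_real (ℓ := ℓ) hMh1 c.1.1
  have hS8 := Mh_le_bigSide (ℓ := ℓ) (Mh := Mh) c.1.1
  have hM1 : (1 : ℝ) ≤ Mh := by exact_mod_cast hMh1
  have hM8r : (8 : ℝ) ≤ Mh := by exact_mod_cast hM8
  have hl : (1 : ℝ) ≤ ℓ := by exact_mod_cast (by have := hL.2; omega : 1 ≤ ℓ)
  have hS0 : (0 : ℝ) ≤ (bigSide ℓ Mh c.1.1 : ℝ) := by positivity
  have h16 : (16 : ℝ) ≤ (bigSide ℓ Mh c.1.1 : ℝ) := by nlinarith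
  have hdist : dist (toR (toBox hN x).1) (ctr (Dch D c) (cc D hMh1 hP4 c)) ≤ rho ℓ Mh c.1.1 := by
    refine (dist_pi_le_iff (by unfold rho; positivity)).2 fun μ => ?_
    rw [Real.dist_eq, ← lab_eq_toR hN x]
    have h := (hx μ).le
    unfold Mc at h
    unfold rho
    nlinarith [mul_nonneg (sub_nonneg.2 hl) hS0]
  have hlev : (D.chart (svec ℓ k c.1.1 c.1.2)).lev (toBox hN x) ≤ j0 hMh1 hP4 c + 1 := (two_level hMh1 hP4 c hL hR2 hdist).2
  have hj := (j0_le_level hMh1 hP4 c hL hR2).1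
  rw [len_blkS]
  have hL1 : (1 : ℝ) ≤ (ℓ : ℝ) + 1 := by linarith
  calc ((ℓ : ℝ) + 1) ^ (D.chart (svec ℓ k c.1.1 c.1.2)).lev (toBox hN x) ≤ ((ℓ : ℝ) + 1) ^ (c.1.1 + 1) :=
        pow_le_pow_right₀ hL1 (by omega)
    _ ≤ (bigSide ℓ Mh c.1.1 : ℝ) := by
        unfold bigSide; push_cast
        have hp : (0 : ℝ) ≤ ((ℓ : ℝ) + 1) ^ (c.1.1 + 1) := by positivity
        nlinarith
    _ ≤ Mc ℓ Mh c.1.1 := by unfold Mc; nlinarith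

include hMha in
/-- **THE ZONE OF `χ_□` IS NON-EMPTY**: the corner `x₀` of the window is a V1 site with `χ_□ = 0`. [cite: Balaban1984PropagatorsII, p.238, bookkeeping] -/
theorem zone_nonempty (hℓ : 4 ≤ ℓ) (hM8 : 8 ≤ Mh) (hpl : Placed ℓ k P' c.1) :
    (zoneN hN (D.chart (svec ℓ k c.1.1 c.1.2)) (chiC hMh1 hP4 c)).Nonempty := by
  -- the corner as a box point, and the V1 site charted to it
  have hz : x0 ℓ Mh k c.1 ∈ boxDom (N0 ℓ Mh k P') := by
    refine mem_boxDom.2 fun μ => ⟨hx0 hpl μ, ?_⟩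
    have h := hfit hN hMh1 hP4 hMha c (le_refl (0 : ℝ)) hpl μ
    have hpos : 0 < ((bare d ℓ hd hL (eC a c.1.1) 0 (j0 hMh1 hP4 c) (j0_hj hMh1 hP4 c a) (le_refl (0 : ℝ))).P.sitesPerDir 0 : ℕ) :=
      Nat.pos_of_ne_zero (Params.sitesPerDir_ne_zero _ 0)
    rw [← hN μ] at h
    omega
  obtain ⟨x, hx⟩ := toBox_surjective hN ⟨x0 ℓ Mh k c.1, hz⟩
  refine zoneN_nonempty hN _ _ (chiS_ne_one_of_corner (ctr (Dch D c) (cc D hMh1 hP4 c)) (hlo_cube hMh1 hP4 c hL hℓ hM8)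
    (Mc_pos hMh1 c.1.1) (x := x) ⟨⟨0, hd⟩, ?_⟩)
  have := congrArg (fun z : ↥(boxDom (N0 ℓ Mh k P')) => (z : Fin (d + 1) → ℤ) ⟨0, hd⟩) hx
  simpa only [toBox_apply] using this

end Chi

/-! ## §4  The depth `M₀ = M_h/(4L)` of the cut-offs below the zone and below the faces of the window (glued distance `d′`) -/

section Depth

variable (hN : ∀ μ, N0 ℓ Mh k P' μ = (PV d ℓ m K hd hL).sitesPerDir 0) {D : TDomains d ℓ Mh k P' R} (hk : k ≤ m + K)
  (hMh1 : 1 ≤ Mh) (hP4 : ∀ μ, 4 ≤ P' μ) {a : ℕ} (hMha : Mh = (ℓ + 1) ^ a) (c : ↥(cubes D.toDomains)) (ha : a₀ ≤ a₁)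

include hMha ha in
/-- **THE ZONE BLOCKS ARE FAR**: a block of the zone of `χ_□` contains a site `≥ 2S_j − 1` from the centre in some coordinate.
[cite: Balaban1984PropagatorsII, p.247 («ζ_□(y) − 1 = 0 for d(y, y′) ≦ M»), p.238; bookkeeping ours] -/
theorem far_of_mem_zone (hℓ : 4 ≤ ℓ) (hM8 : 8 ≤ Mh) (hpl : Placed ℓ k P' c.1)
    (wc : BondIdx (domT hN (D.chart (svec ℓ k c.1.1 c.1.2)) hk) → ℝ) (cf : ℝ) {n : ↥(bset (Dch D c))}
    (hn : n ∈ zoneN hN (D.chart (svec ℓ k c.1.1 c.1.2)) (chiC hMh1 hP4 c)) :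
    ∃ x' : ↥(boxDom (N0 ℓ Mh k P')), blkOf (Dch D c) x' = n ∧
      ∃ μ, 2 * (bigSide ℓ Mh c.1.1 : ℝ) - 1 ≤ |toR x'.1 μ - ctr (Dch D c) (cc D hMh1 hP4 c) μ| := by
  obtain ⟨x, hxn, μ, hμ⟩ := exists_far_of_mem_zoneN hN (D.chart (svec ℓ k c.1.1 c.1.2)) (ctr (Dch D c) (cc D hMh1 hP4 c))
    (hx0 hpl) (hfitC hN hk hMh1 hP4 hMha c ha hpl wc cf) (hlo_cube hMh1 hP4 c hL hℓ hM8)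
    (hhi_cube hN hk hMh1 hP4 hMha c ha hM8 wc cf) (Mc_pos hMh1 c.1.1) hn
  refine ⟨toBox hN x, hxn, μ, ?_⟩
  rw [lab_eq_toR hN] at hμ
  unfold Mc at hμ
  linarith

include hMha in
/-- **THE FACE BLOCKS ARE FAR**: a face block of the window contains a site `≥ L·S_j/2 ≥ 2S_j − 1` from the centre in some coordinate.
[cite: Balaban1984PropagatorsII, p.238 (□̃³ and its identification with T_□); bookkeeping ours] -/
theorem far_of_mem_face (hℓ : 4 ≤ ℓ) (wc : BondIdx (domT hN (D.chart (svec ℓ k c.1.1 c.1.2)) hk) → ℝ) (cf : ℝ) {n : ↥(bset (Dch D c))}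
    (hn : n ∈ FaceBlk (m := m) (K := K) hN (D.chart (svec ℓ k c.1.1 c.1.2)) (tC hN hk hMh1 hP4 c ha a wc cf) (x0 ℓ Mh k c.1)) :
    ∃ x' : ↥(boxDom (N0 ℓ Mh k P')), blkOf (Dch D c) x' = n ∧
      ∃ μ, 2 * (bigSide ℓ Mh c.1.1 : ℝ) - 1 ≤ |toR x'.1 μ - ctr (Dch D c) (cc D hMh1 hP4 c) μ| := by
  obtain ⟨x, -, hxn, μ, hμ⟩ := hn
  refine ⟨toBox hN x, hxn, μ, ?_⟩
  have ex : toR (toBox hN x).1 μ = (((x μ).val : ℕ) : ℝ) := by simp [toR, toBox_apply]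
  have e0 := x0_eq_ctr_sub hL hMh1 hP4 c μ
  have hS := one_le_bigSide_real (ℓ := ℓ) hMh1 c.1.1
  have hl : (4 : ℝ) ≤ ℓ := by exact_mod_cast hℓ
  rw [ex]
  rcases hμ with h | h
  · have h' : (((x μ).val : ℕ) : ℝ) = (x0 ℓ Mh k c.1 μ : ℝ) := by exact_mod_cast h
    rw [h', e0, abs_of_nonpos (by nlinarith)]
    nlinarith
  · rw [tC_sites hN hk hMh1 hP4 hMha c ha] at h
    have h' : (((x μ).val : ℕ) : ℝ) + 1 = (x0 ℓ Mh k c.1 μ : ℝ) + ((2 * ((ℓ + 1) * bigSide ℓ Mh c.1.1) : ℕ) : ℝ) := by exact_mod_cast h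
    push_cast at h'
    rw [abs_of_nonneg (by nlinarith)]
    nlinarith

include hMha in
/-- **THE DEPTH `M₀ = M_h/(4L)`**: a block of `□̃` (a block of `supp ζ^ch_□` or `supp h^ch_□`) is `≥ M_h/(4L)` from every zone block in the GLUED
distance `d′` (`le_distW_of_far`: the glued geodesic either stays in the torus — `distT_far` against the zone — or passes a face block first —
`distT_far` against the faces). [cite: Balaban1984PropagatorsII, (2.46) p.231, p.247 («ζ_□(y) − 1 = 0 for d(y, y′) ≦ M»), p.238; derivation ours] -/
theorem depth_cube (hk2 : 2 ≤ k) (hℓ : 4 ≤ ℓ) (hM16 : 16 ≤ Mh) (hR2 : 2 * (ℓ + 1) ^ 2 ≤ R) (hP5 : ∀ μ, 5 ≤ P' μ) (hpl : Placed ℓ k P' c.1)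
    (wc : BondIdx (domT hN (D.chart (svec ℓ k c.1.1 c.1.2)) hk) → ℝ) (cf : ℝ) {v : PBond (PV d ℓ m K hd hL) 0}
    (hv : blkS hN (D.chart (svec ℓ k c.1.1 c.1.2)) v.src ∈ Qbig (Dch D c) (cc D hMh1 hP4 c)) {n : ↥(bset (Dch D c))}
    (hn : n ∈ zoneN hN (D.chart (svec ℓ k c.1.1 c.1.2)) (chiC hMh1 hP4 c)) :
    (Mh : ℝ) / (4 * ((ℓ : ℝ) + 1)) ≤
      (geomW hN (D.chart (svec ℓ k c.1.1 c.1.2)) (hx0 hpl) (hfitC hN hk hMh1 hP4 hMha c ha hpl wc cf)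
          (hN1_cube hN hk hMh1 hP4 hMha c ha (le_trans (by norm_num) hM16) hR2 wc cf) (Dmem hN hk hMh1 hP4 c ha hk2 a wc cf)).dist
        (blkV1 hN (D.chart (svec ℓ k c.1.1 c.1.2)) v) n := by
  have hM8 : 8 ≤ Mh := le_trans (by norm_num) hM16
  have hℓ1 : 1 ≤ ℓ := le_trans (by norm_num) hℓ
  have hP1 : ∀ μ, 1 ≤ P' μ := one_le_of_four_le hP4
  refine le_distW_of_far hN (D.chart (svec ℓ k c.1.1 c.1.2)) (hx0 hpl) (hfitC hN hk hMh1 hP4 hMha c ha hpl wc cf) _ _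
    (hlevW_cube hN hk hMh1 hP4 hMha c ha hk2 hM8 hR2 hpl wc cf) (hal_cube hMh1 hP4 c hL hR2) hMh1 hP1 ?_ ?_
  · exact distT_far hℓ1 hM16 hR2 hP5 c hv (far_of_mem_zone hN hk hMh1 hP4 hMha c ha hℓ hM8 hpl wc cf hn)
  · intro a' ha'
    exact (distT_far hℓ1 hM16 hR2 hP5 c hv (far_of_mem_face hN hk hMh1 hP4 hMha c ha hℓ wc cf ha')).trans (le_add_of_nonneg_right zero_le_one)

end Depth

/-! ## §5  The diameter of `□̃` in the torus distance: `d_T(y, y′) ≤ (d+1)(4L²+1)·M_h` for blocks `y, y′` of `□̃` -/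

section Diam

variable (hN : ∀ μ, N0 ℓ Mh k P' μ = (PV d ℓ m K hd hL).sitesPerDir 0) {D : TDomains d ℓ Mh k P' R}
  (hMh1 : 1 ≤ Mh) (hP4 : ∀ μ, 4 ≤ P' μ) (c : ↥(cubes D.toDomains))

/-- **THE BLOCKS OF `□̃` ARE PAIRWISE `≤ (d+1)(4L²+1)·M_h` APART IN THE TORUS DISTANCE (2.46)**: their sites are within `29S_j/8` of each other in the
sup norm, the lattice box they span lies in the two-level ball (levels `≥ j₀`, `L^{j₀} ≥ S_j/(M_hL²)`), and the staircase bound `dist_blkOf_le_box` applies.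
[cite: Balaban1984PropagatorsII, (2.46) p.231, p.231–232 («d(x, x′) = d(y, y′) if x ∈ B^j(y)»), (2.2) p.224; derivation ours] -/
theorem distT_le_of_mem_Qbig (hL : Odd (ℓ + 1) ∧ 1 < ℓ + 1) (hM8 : 8 ≤ Mh) (hR2 : 2 * (ℓ + 1) ^ 2 ≤ R) {y y' : ↥(bset (Dch D c))}
    (hy : y ∈ Qbig (Dch D c) (cc D hMh1 hP4 c)) (hy' : y' ∈ Qbig (Dch D c) (cc D hMh1 hP4 c)) :
    (geomTB (D.chart (svec ℓ k c.1.1 c.1.2))).dist y y' ≤ ((d : ℝ) + 1) * (4 * ((ℓ : ℝ) + 1) ^ 2 + 1) * Mh := by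
  have hP1 : ∀ μ, 1 ≤ P' μ := one_le_of_four_le hP4
  have hℓ1 : 1 ≤ ℓ := by have := hL.2; omega
  have hR : 3 * (ℓ + 1) ≤ R := le_trans (by nlinarith) hR2
  have hS := one_le_bigSide_real (ℓ := ℓ) hMh1 c.1.1
  have hS0 : (0 : ℝ) ≤ (bigSide ℓ Mh c.1.1 : ℝ) := by positivity
  have hl : (1 : ℝ) ≤ ℓ := by exact_mod_cast hℓ1
  have hM1 : (1 : ℝ) ≤ Mh := by exact_mod_cast hMh1
  obtain ⟨x, rfl⟩ := exists_blkOf_eq (Dch D c) y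
  obtain ⟨x', rfl⟩ := exists_blkOf_eq (Dch D c) y'
  have hx := fun μ => abs_sub_ctr_le_of_mem_Qbig (Dch D c) hM8 hR hy (x := x) rfl μ
  have hx' := fun μ => abs_sub_ctr_le_of_mem_Qbig (Dch D c) hM8 hR hy' (x := x') rfl μ
  simp only [side_cc] at hx hx'
  -- the torus distance is below the box distance, which is below the staircase bound at level `j₀`
  have h1 := distT_le_dist_box (D := D.chart (svec ℓ k c.1.1 c.1.2)) hMh1 hP1 (blkOf (Dch D c) x) (blkOf (Dch D c) x')
  have hlev : ∀ z ∈ boxDom (N0 ℓ Mh k P'), (∀ μ, min (x.1 μ) (x'.1 μ) ≤ z μ ∧ z μ ≤ max (x.1 μ) (x'.1 μ)) →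
      j0 hMh1 hP4 c ≤ (Dch D c).lev z := by
    intro z hz hzb
    refine (two_level hMh1 hP4 c hL hR2 (w := ⟨z, hz⟩) ?_).1
    refine (dist_pi_le_iff (by unfold rho; positivity)).2 fun μ => ?_
    rw [Real.dist_eq]
    have h1 := hx μ
    have h2 := hx' μ
    obtain ⟨hlo, hhi⟩ := hzb μ
    rw [abs_le] at h1 h2
    have exμ : toR x.1 μ = (x.1 μ : ℝ) := rfl
    have exμ' : toR x'.1 μ = (x'.1 μ : ℝ) := rfl
    rw [exμ] at h1
    rw [exμ'] at h2
    show |((z μ : ℤ) : ℝ) - ctr (Dch D c) (cc D hMh1 hP4 c) μ| ≤ rho ℓ Mh c.1.1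
    unfold rho
    rw [abs_le]
    have hlS := mul_nonneg (sub_nonneg.2 hl) hS0
    constructor
    · rcases min_le_iff.1 hlo with h | h
      · have h' : ((x.1 μ : ℤ) : ℝ) ≤ (z μ : ℝ) := by exact_mod_cast h
        nlinarith
      · have h' : ((x'.1 μ : ℤ) : ℝ) ≤ (z μ : ℝ) := by exact_mod_cast h
        nlinarith
    · rcases le_max_iff.1 hhi with h | h
      · have h' : (z μ : ℝ) ≤ ((x.1 μ : ℤ) : ℝ) := by exact_mod_cast h
        nlinarith
      · have h' : (z μ : ℝ) ≤ ((x'.1 μ : ℤ) : ℝ) := by exact_mod_cast h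
        nlinarith
  have h2 := dist_blkOf_le_box (D := Dch D c) hMh1 hP1 (i := j0 hMh1 hP4 c) x x' hlev
  -- the span: `|x − x′|_∞ ≤ 29S/8`
  have hsup : supNorm (x.1 - x'.1) ≤ 29 / 8 * (bigSide ℓ Mh c.1.1 : ℝ) := by
    rw [supNorm_eq_dist]
    refine (dist_pi_le_iff (by positivity)).2 fun μ => ?_
    rw [Real.dist_eq]
    have h1 := hx μ
    have h2 := hx' μ
    rw [abs_le] at h1 h2 ⊢
    constructor <;> linarith
  -- `L^{j₀} ≥ S_j/(M_h·L²)`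
  have hj := (j0_le_level hMh1 hP4 c hL hR2).2
  have hpow : (bigSide ℓ Mh c.1.1 : ℝ) ≤ (Mh : ℝ) * ((ℓ : ℝ) + 1) ^ 2 * ((((ℓ + 1) ^ j0 hMh1 hP4 c : ℕ)) : ℝ) := by
    unfold bigSide; push_cast
    have hL1 : (1 : ℝ) ≤ (ℓ : ℝ) + 1 := by linarith
    have e : ((ℓ : ℝ) + 1) ^ 2 * ((ℓ : ℝ) + 1) ^ j0 hMh1 hP4 c = ((ℓ : ℝ) + 1) ^ (j0 hMh1 hP4 c + 2) := by ring
    have hp : ((ℓ : ℝ) + 1) ^ (c.1.1 + 1) ≤ ((ℓ : ℝ) + 1) ^ (j0 hMh1 hP4 c + 2) := pow_le_pow_right₀ hL1 (by omega)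
    have hM0 : (0 : ℝ) ≤ Mh := Nat.cast_nonneg _
    calc (Mh : ℝ) * ((ℓ : ℝ) + 1) ^ (c.1.1 + 1) ≤ (Mh : ℝ) * ((ℓ : ℝ) + 1) ^ (j0 hMh1 hP4 c + 2) := mul_le_mul_of_nonneg_left hp hM0
      _ = (Mh : ℝ) * ((ℓ : ℝ) + 1) ^ 2 * ((ℓ : ℝ) + 1) ^ j0 hMh1 hP4 c := by rw [← e]; ring
  have hLj : (0 : ℝ) < ((((ℓ + 1) ^ j0 hMh1 hP4 c : ℕ)) : ℝ) := by positivity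
  have hquot : supNorm (x.1 - x'.1) / ((((ℓ + 1) ^ j0 hMh1 hP4 c : ℕ)) : ℝ) ≤ 29 / 8 * ((Mh : ℝ) * ((ℓ : ℝ) + 1) ^ 2) := by
    rw [div_le_iff₀ hLj]
    nlinarith
  have h1' : (geomTB (D.chart (svec ℓ k c.1.1 c.1.2))).dist (blkOf (Dch D c) x) (blkOf (Dch D c) x') ≤
      (((bond (Dch D c)).dist (blkOf (Dch D c) x) (blkOf (Dch D c) x') : ℕ) : ℝ) := by
    show (((bondT (D.chart (svec ℓ k c.1.1 c.1.2))).dist (blkOf (Dch D c) x) (blkOf (Dch D c) x') : ℕ) : ℝ) ≤ _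
    exact_mod_cast h1
  refine h1'.trans (h2.trans ?_)
  have hd0 : (0 : ℝ) ≤ (d : ℝ) + 1 := by positivity
  have hq2 : supNorm (x.1 - x'.1) / ((((ℓ + 1) ^ j0 hMh1 hP4 c : ℕ)) : ℝ) + 1 ≤ (4 * ((ℓ : ℝ) + 1) ^ 2 + 1) * Mh := by
    nlinarith [sq_nonneg ((ℓ : ℝ) + 1)]
  calc ((d : ℝ) + 1) * (supNorm (x.1 - x'.1) / ((((ℓ + 1) ^ j0 hMh1 hP4 c : ℕ)) : ℝ) + 1)
      ≤ ((d : ℝ) + 1) * ((4 * ((ℓ : ℝ) + 1) ^ 2 + 1) * Mh) := mul_le_mul_of_nonneg_left hq2 hd0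
    _ = _ := by ring

end Diam

/-! ## §6  Cut-off sandwiches on the glued geometry see only located pairs: from `d′` to `d_T` at the price `e^{ρΔ}` (diameter `Δ` of the located pairs) -/

section Cut

variable (hN : ∀ μ, N0 ℓ Mh k P' μ = (PV d ℓ m K hd hL).sitesPerDir 0) (D : TDomains d ℓ Mh k P' R)
variable {t : TSIdx d (ℓ + 1) hd hL a₀ a₁} {x₀ : Fin (d + 1) → ℤ}
variable (hx₀ : ∀ μ, 0 ≤ x₀ μ) (hfit : ∀ μ, x₀ μ + (t.P.sitesPerDir 0 : ℕ) ≤ ((PV d ℓ m K hd hL).sitesPerDir 0 : ℕ))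
variable {Mh₁ k₁ R₁ : ℕ} {P₁ : Fin (d + 1) → ℕ}
variable (hN₁ : ∀ μ, N0 ℓ Mh₁ k₁ P₁ μ = (PV d ℓ t.m t.K hd hL).sitesPerDir 0) (D₁ : TDomains d ℓ Mh₁ k₁ P₁ R₁)

/-- **FROM THE GLUED DISTANCE TO THE TORUS DISTANCE ON LOCATED PAIRS OF BOUNDED DIAMETER**: a majorant `F(y)·e^{−r·d′(y,y″)}` (`r ≥ 0`) of a cut-off
sandwich `ζ·X·h` on the glued geometry gives the majorant `F(y)·e^{ρΔ}·e^{−ρ·d_T(y,y″)}` on the torus geometry for every `ρ ≥ 0`, when the blocks of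
`supp ζ` and of `supp h` are pairwise `≤ Δ` apart in `d_T` (rows off `supp ζ` and columns off `supp h` carry the zero operator; on located pairs
`e^{−r d′} ≤ 1 ≤ e^{ρΔ − ρ d_T}`). [cite: Balaban1984PropagatorsII, (2.92) p.239 line 3 («ζ_□ … h_□»), (2.46) p.231; derivation ours] -/
theorem hasMajorant_cut_of_diam {X : Module.End ℝ (PBond (PV d ℓ m K hd hL) 0 → ℝ)} (ζ h : PBond (PV d ℓ m K hd hL) 0 → ℝ)
    {F : ↥(bset D.toDomains) → ℝ} {r : ℝ}
    (hW : HasMajorant (g := geomW hN D hx₀ hfit hN₁ D₁) (blkV1 hN D) (mulOp ζ * X * mulOp h)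
      (fun a b => F a * Real.exp (-(r * (geomW hN D hx₀ hfit hN₁ D₁).dist a b))))
    {Δ : ℝ} (hdiam : ∀ v, ζ v ≠ 0 → ∀ v', h v' ≠ 0 → (geomTB D).dist (blkV1 hN D v) (blkV1 hN D v') ≤ Δ) (hr : 0 ≤ r) {ρ : ℝ} (hρ : 0 ≤ ρ) :
    HasMajorant (g := geomTB D) (blkV1 hN D) (mulOp ζ * X * mulOp h)
      (fun a b => F a * Real.exp (ρ * Δ) * Real.exp (-(ρ * (geomTB D).dist a b))) := by
  intro y' μ B hμ v
  have hB : 0 ≤ B := hμ.nonneg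
  -- `F ≥ 0` on the row block, from the majorant at `μ = 0`
  have hF : 0 ≤ F (blkV1 hN D v) := by
    have h0 := hW y' 0 1 ⟨zero_le_one, fun x _ => by simp, fun x _ => rfl⟩ v
    rw [map_zero, Pi.zero_apply, abs_zero, mul_one] at h0
    exact (mul_nonneg_iff_of_pos_right (Real.exp_pos _)).1 h0
  have hK0 : 0 ≤ F (blkV1 hN D v) * Real.exp (ρ * Δ) * Real.exp (-(ρ * (geomTB D).dist (blkV1 hN D v) y')) * B := by positivity
  by_cases hζ : ζ v = 0
  · rw [Module.End.mul_apply, Module.End.mul_apply, mulOp_apply, hζ, zero_mul, abs_zero]; exact hK0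
  by_cases hcol : ∃ v', h v' ≠ 0 ∧ blkV1 hN D v' = y'
  · obtain ⟨v', hv', hv'y⟩ := hcol
    have h0 := hW y' μ B ⟨hμ.nonneg, hμ.bound, hμ.off⟩ v
    rw [← hv'y] at h0 ⊢
    dsimp only at h0 ⊢
    have hd := hdiam v hζ v' hv'
    have hdW := distW_nonneg hN D hx₀ hfit hN₁ D₁ (blkV1 hN D v) (blkV1 hN D v')
    refine h0.trans (mul_le_mul_of_nonneg_right ?_ hB)
    have h1 : Real.exp (-(r * (geomW hN D hx₀ hfit hN₁ D₁).dist (blkV1 hN D v) (blkV1 hN D v'))) ≤ 1 :=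
      Real.exp_le_one_iff.2 (by nlinarith)
    have h2 : 1 ≤ Real.exp (ρ * Δ) * Real.exp (-(ρ * (geomTB D).dist (blkV1 hN D v) (blkV1 hN D v'))) := by
      rw [← Real.exp_add]
      exact Real.one_le_exp (by nlinarith)
    calc F (blkV1 hN D v) * Real.exp (-(r * (geomW hN D hx₀ hfit hN₁ D₁).dist (blkV1 hN D v) (blkV1 hN D v')))
        ≤ F (blkV1 hN D v) * 1 := mul_le_mul_of_nonneg_left h1 hF
      _ ≤ F (blkV1 hN D v) * (Real.exp (ρ * Δ) * Real.exp (-(ρ * (geomTB D).dist (blkV1 hN D v) (blkV1 hN D v')))) :=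
        mul_le_mul_of_nonneg_left h2 hF
      _ = _ := by ring
  · -- otherwise `h·μ = 0`, so the whole term vanishes
    have hμ0 : mulOp h μ = 0 := by
      funext x
      rw [mulOp_apply, Pi.zero_apply]
      by_cases hx : blkV1 hN D x = y'
      · by_cases hh : h x = 0
        · rw [hh, zero_mul]
        · exact absurd ⟨x, hh, hx⟩ hcol
      · rw [hμ.off x hx, mul_zero]
    rw [Module.End.mul_apply, Module.End.mul_apply, hμ0, map_zero, map_zero, Pi.zero_apply, abs_zero]; exact hK0

omit hx₀ hfit hN₁ D₁ in
/-- equal operators have the same majorants. [folklore] -/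
private theorem hasMajorant_of_eq {g : B6.Geometry} {T T' : Module.End ℝ (PBond (PV d ℓ m K hd hL) 0 → ℝ)} {blk' : PBond (PV d ℓ m K hd hL) 0 → g.Site}
    {Kk : g.Site → g.Site → ℝ} (h : T' = T) (hm : HasMajorant (g := g) blk' T Kk) : HasMajorant (g := g) blk' T' Kk := h ▸ hm

end Cut

/-! ## §7  The operator of line 3 for the cube: global = conjugate of the chart frame; chart frame = `line3_window`'s operator -/

section Identify

variable (hN : ∀ μ, N0 ℓ Mh k P' μ = (PV d ℓ m K hd hL).sitesPerDir 0) {D : TDomains d ℓ Mh k P' R} (hk : k ≤ m + K)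
  (hMh1 : 1 ≤ Mh) (hP4 : ∀ μ, 4 ≤ P' μ) {a : ℕ} (hMha : Mh = (ℓ + 1) ^ a) (c : ↥(cubes D.toDomains)) (ha : a₀ ≤ a₁)

omit hN hk hMh1 hP4 c in
/-- conjugates subtract. [cite: Balaban1984PropagatorsII, (2.19) p.226, dictionary] -/
private theorem conj_sub (v : Site (PV d ℓ m K hd hL) 0) (A B : Module.End ℝ (PBond (PV d ℓ m K hd hL) 0 → ℝ)) :
    TB (-v) * A * TB v - TB (-v) * B * TB v = TB (-v) * (A - B) * TB v := by
  rw [mul_sub, sub_mul]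

include hMha in
/-- **THE LINE-3 OPERATOR OF THE CUBE IS THE CONJUGATE OF ITS CHART-FRAME VERSION**: `ζ_□(∂(1−R)∂* − P_□)h_□ = τ_{−v}·(ζ^ch_□(∂(1−R^ch)∂* − P^ch_□)h^ch_□)·τ_v`
(`B6TranslateTorusV1.onFun_dgPart_eq_conj`, `mulOp_eq_conj`, `Pl = τ_{−v}PlCτ_v`). [cite: Balaban1984PropagatorsII, (2.19) p.226, (2.91)–(2.92) p.239, dictionary (charts)] -/
theorem target_eq_conj (hpl : Placed ℓ k P' c.1) (w : BondIdx (domT hN D hk) → ℝ) (cf : ℝ) :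
    mulOp (zB hN D hMh1 hP4 c) * (onFun (dE (P := PV d ℓ m K hd hL) cf ∘ₗ (LinearMap.id - RE (domT hN D hk) cf) ∘ₗ dsE cf) -
        Pl hN hk hMh1 hP4 hMha c ha hpl w cf) * mulOp (hB hN D c) =
      TB (-vch Mh k (svec ℓ k c.1.1 c.1.2)) *
        (mulOp (zch hN hMh1 hP4 c) *
          (onFun (dE (P := PV d ℓ m K hd hL) cf ∘ₗ (LinearMap.id - RE (domT hN (D.chart (svec ℓ k c.1.1 c.1.2)) hk) cf) ∘ₗ dsE cf) -
            PlC hN hk hMh1 hP4 hMha c ha hpl (wC hN hk c w) cf) * mulOp (hch hN hMh1 hP4 c)) *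
        TB (vch Mh k (svec ℓ k c.1.1 c.1.2)) := by
  rw [mulOp_eq_conj (vch Mh k (svec ℓ k c.1.1 c.1.2)) (zB hN D hMh1 hP4 c), mulOp_eq_conj (vch Mh k (svec ℓ k c.1.1 c.1.2)) (hB hN D c),
    trV_hB hN hMh1 hP4 c, onFun_dgPart_eq_conj hN D hk (svec ℓ k c.1.1 c.1.2) cf, Pl, conj_sub, conj_mul, conj_mul]

include hMha in
/-- **THE CHART-FRAME LINE-3 OPERATOR OF THE CUBE IS `line3_window`'s OPERATOR** for the member `t(□)` and its family `D_□`: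
`∂(1−R^ch)∂* = ∂·G′SG′·∂*` (`onFun_oneSubRE_eq`), `P^ch_□ = ε_B(∂_□P_□∂*_□)ρ_B` with the unit `s(□)` absorbed by the rescaling of the stencils
(`onFun_dE_dsE_rescale`), `= ∂(ε_S P_□ ρ_S)∂*` between the deep cut-offs (`sandwich_transplant_eq`), `P_□ = G′_□S_□G′_□` (`onFun_tsV1_P` with
`lam_tOf_sat`) and `ε(G′_□S_□G′_□)ρ = G̃′_□S̃_□G̃′_□` (`transplant_GSG`). [cite: Balaban1984PropagatorsII, (2.17) p.225, (2.90)–(2.92) p.239; derivation ours] -/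
theorem chart_eq_line3 (hk2 : 2 ≤ k) (hM8 : 8 ≤ Mh) (hR2 : 2 * (ℓ + 1) ^ 2 ≤ R) (hpl : Placed ℓ k P' c.1)
    (wc : BondIdx (domT hN (D.chart (svec ℓ k c.1.1 c.1.2)) hk) → ℝ) {cf : ℝ} (hcf : cf ≠ 0)
    (hζd : ∀ b, zch hN hMh1 hP4 c b ≠ 0 → b.src ∈ DeepS (tC hN hk hMh1 hP4 c ha a wc cf) (x0 ℓ Mh k c.1) 1)
    (hhd : ∀ b, hch hN hMh1 hP4 c b ≠ 0 → b.src ∈ DeepS (tC hN hk hMh1 hP4 c ha a wc cf) (x0 ℓ Mh k c.1) 1) :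
    mulOp (zch hN hMh1 hP4 c) *
        (onFun (dE (P := PV d ℓ m K hd hL) cf ∘ₗ (LinearMap.id - RE (domT hN (D.chart (svec ℓ k c.1.1 c.1.2)) hk) cf) ∘ₗ dsE cf) -
          PlC hN hk hMh1 hP4 hMha c ha hpl wc cf) * mulOp (hch hN hMh1 hP4 c) =
      mulOp (zch hN hMh1 hP4 c) * ((onFun (dE (P := PV d ℓ m K hd hL) cf) ∘ₗ
          (GpV hN (D.chart (svec ℓ k c.1.1 c.1.2)) cf * SV hN (D.chart (svec ℓ k c.1.1 c.1.2)) cf * GpV hN (D.chart (svec ℓ k c.1.1 c.1.2)) cf -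
            transplant (cS (tC hN hk hMh1 hP4 c ha a wc cf) (x0 ℓ Mh k c.1) (hx0 hpl) (hfitC hN hk hMh1 hP4 hMha c ha hpl wc cf)).W
                (eS (tC hN hk hMh1 hP4 c ha a wc cf) (x0 ℓ Mh k c.1))
                (GpV (hN1_cube hN hk hMh1 hP4 hMha c ha hM8 hR2 wc cf) (Dmem hN hk hMh1 hP4 c ha hk2 a wc cf) cf) *
              transplant (cS (tC hN hk hMh1 hP4 c ha a wc cf) (x0 ℓ Mh k c.1) (hx0 hpl) (hfitC hN hk hMh1 hP4 hMha c ha hpl wc cf)).W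
                (eS (tC hN hk hMh1 hP4 c ha a wc cf) (x0 ℓ Mh k c.1))
                (SV (hN1_cube hN hk hMh1 hP4 hMha c ha hM8 hR2 wc cf) (Dmem hN hk hMh1 hP4 c ha hk2 a wc cf) cf) *
              transplant (cS (tC hN hk hMh1 hP4 c ha a wc cf) (x0 ℓ Mh k c.1) (hx0 hpl) (hfitC hN hk hMh1 hP4 hMha c ha hpl wc cf)).W
                (eS (tC hN hk hMh1 hP4 c ha a wc cf) (x0 ℓ Mh k c.1))
                (GpV (hN1_cube hN hk hMh1 hP4 hMha c ha hM8 hR2 wc cf) (Dmem hN hk hMh1 hP4 c ha hk2 a wc cf) cf))) ∘ₗ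
          onFun (dsE (P := PV d ℓ m K hd hL) cf)) * mulOp (hch hN hMh1 hP4 c) := by
  classical
  have hℓ1 : 1 ≤ ℓ := by have := hL.2; omega
  have hk1 : 1 ≤ k := by omega
  have hP1 : ∀ μ, 1 ≤ P' μ := one_le_of_four_le hP4
  have hP₁1 : ∀ μ, 1 ≤ P1 hMh1 hP4 c μ := fun μ => le_trans (by norm_num) (four_le_P1 hMh1 hP4 c hℓ1 μ)
  have hLj : ((((ℓ + 1 : ℕ) : ℝ)) ^ j0 hMh1 hP4 c) ≠ 0 := by positivity
  -- (i) the global part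
  have e1 : onFun (dE (P := PV d ℓ m K hd hL) cf ∘ₗ (LinearMap.id - RE (domT hN (D.chart (svec ℓ k c.1.1 c.1.2)) hk) cf) ∘ₗ dsE cf) =
      onFun (dE (P := PV d ℓ m K hd hL) cf) ∘ₗ
        (GpV hN (D.chart (svec ℓ k c.1.1 c.1.2)) cf * SV hN (D.chart (svec ℓ k c.1.1 c.1.2)) cf * GpV hN (D.chart (svec ℓ k c.1.1 c.1.2)) cf) ∘ₗ
        onFun (dsE (P := PV d ℓ m K hd hL) cf) := by
    rw [onFun_comp, onFun_comp, onFun_oneSubRE_eq hN (D.chart (svec ℓ k c.1.1 c.1.2)) hk hℓ1 hMh1 hP1 hcf]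
  -- (ii) the member part, unit absorbed
  have e2 : PlC hN hk hMh1 hP4 hMha c ha hpl wc cf =
      transplant (cB (tC hN hk hMh1 hP4 c ha a wc cf) (x0 ℓ Mh k c.1) (hx0 hpl) (hfitC hN hk hMh1 hP4 hMha c ha hpl wc cf)).W
        (eB (tC hN hk hMh1 hP4 c ha a wc cf) (x0 ℓ Mh k c.1))
        (onFun (dE (P := (tC hN hk hMh1 hP4 c ha a wc cf).P) cf) ∘ₗ onFun (tC hN hk hMh1 hP4 c ha a wc cf).D.P ∘ₗ
          onFun (dsE (P := (tC hN hk hMh1 hP4 c ha a wc cf).P) cf)) := by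
    rw [PlC, ← transplant_eB_eq]
    have e3 : onFun ((tC hN hk hMh1 hP4 c ha a wc cf).D.grad ∘ₗ (tC hN hk hMh1 hP4 c ha a wc cf).D.P ∘ₗ (tC hN hk hMh1 hP4 c ha a wc cf).D.dv) =
        ((((ℓ + 1 : ℕ) : ℝ)) ^ j0 hMh1 hP4 c / cf) ^ 2 •
          onFun (dE (P := (tC hN hk hMh1 hP4 c ha a wc cf).P) cf ∘ₗ (tC hN hk hMh1 hP4 c ha a wc cf).D.P ∘ₗ
            dsE (P := (tC hN hk hMh1 hP4 c ha a wc cf).P) cf) :=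
      onFun_dE_dsE_rescale hcf _ _
    rw [e3, transplant_smul, smul_smul, sc, show (cf / (((ℓ + 1 : ℕ) : ℝ)) ^ j0 hMh1 hP4 c) ^ 2 *
      ((((ℓ + 1 : ℕ) : ℝ)) ^ j0 hMh1 hP4 c / cf) ^ 2 = 1 by field_simp, one_smul, onFun_comp, onFun_comp]
  -- (iii) the member's `P_□ = G′_□S_□G′_□` of `D_□`
  have e4 : onFun (tC hN hk hMh1 hP4 c ha a wc cf).D.P =
      GpV (hN1_cube hN hk hMh1 hP4 hMha c ha hM8 hR2 wc cf) (Dmem hN hk hMh1 hP4 c ha hk2 a wc cf) cf *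
        SV (hN1_cube hN hk hMh1 hP4 hMha c ha hM8 hR2 wc cf) (Dmem hN hk hMh1 hP4 c ha hk2 a wc cf) cf *
        GpV (hN1_cube hN hk hMh1 hP4 hMha c ha hM8 hR2 wc cf) (Dmem hN hk hMh1 hP4 c ha hk2 a wc cf) cf :=
    onFun_tsV1_P (hN1_cube hN hk hMh1 hP4 hMha c ha hM8 hR2 wc cf) (j0_hj hMh1 hP4 c a) (one_le_j0 hMh1 hP4 c hk2) _
      (lam_tOf_sat (j0_succ_le hMh1 hP4 c hk1) (hx0 hpl) (hfitC hN hk hMh1 hP4 hMha c ha hpl wc cf) (hdivB_cube hMh1 hP4 hMha c hL hM8 hR2)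
        (Mh1_dvd hMha hM8) one_le_Mh1 (one_le_j0 hMh1 hP4 c hk2))
      one_le_Mh1 hP₁1 (tC hN hk hMh1 hP4 c ha a wc cf).hc (tC hN hk hMh1 hP4 c ha a wc cf).w hcf
  rw [e1, e2, mul_sub, sub_mul, sandwich_transplant_eq (hx0 hpl) (hfitC hN hk hMh1 hP4 hMha c ha hpl wc cf) cf _ _ _ hζd hhd, e4,
    B6ScalarAgreeV1Chart.transplant_GSG]
  simp only [LinearMap.comp_sub, LinearMap.sub_comp, mul_sub, sub_mul, LinearMap.comp_assoc]

end Identify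

/-! ## §8  LINE 3 OF (2.92) FOR THE GENUINE MEMBER OF EVERY CUBE; Prop. 2.6 (2.136)₁ at k levels with no displayed analytic hypothesis -/

section Main

/-- **ABSORBING THE POLYNOMIAL GROWTH OF THE MEMBER BLOCK COUNT INTO THE DEPTH DECAY**: `G_s ≤ s⁶G₀`, `s = 1 + A₁x^p`, `x ≥ 1` give
`G_s·e^{−c₁x} ≤ G₀·(1+A₁)⁶(6p)!/(c₁/4)^{6p}·e^{−c₁x/2}·e^{−c₁x/4}` (`B6Line3ProfileV1.poly_exp_absorb`). [cite: Balaban1984PropagatorsII, p.238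
(«C_D», «exp(−cM)»); bookkeeping ours] -/
theorem absorb {G₀ Gs c₁ x A₁ s : ℝ} (p : ℕ) (hG₀ : 0 ≤ G₀) (hc₁ : 0 < c₁) (hx : 1 ≤ x) (hA₁ : 0 ≤ A₁)
    (hs : s = 1 + A₁ * x ^ p) (hGs : Gs ≤ s ^ 6 * G₀) :
    Gs * Real.exp (-(c₁ * x)) ≤
      G₀ * ((1 + A₁) ^ 6 * (((6 * p).factorial : ℝ) / (c₁ / 4) ^ (6 * p))) * Real.exp (-(c₁ / 2 * x)) * Real.exp (-(c₁ / 4 * x)) := by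
  have h := poly_exp_absorb hx hA₁ (by positivity : 0 < c₁ / 4) p
  rw [← hs] at h
  have e1 : Real.exp (-(c₁ * x)) = Real.exp (-(2 * (c₁ / 4) * x)) * Real.exp (-(c₁ / 2 * x)) := by
    rw [← Real.exp_add]; congr 1; ring
  have hE := (Real.exp_pos (-(c₁ / 2 * x))).le
  calc Gs * Real.exp (-(c₁ * x)) ≤ s ^ 6 * G₀ * Real.exp (-(c₁ * x)) := mul_le_mul_of_nonneg_right hGs (Real.exp_pos _).le
    _ = G₀ * (s ^ 6 * Real.exp (-(2 * (c₁ / 4) * x))) * Real.exp (-(c₁ / 2 * x)) := by rw [e1]; ring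
    _ ≤ G₀ * ((1 + A₁) ^ 6 * (((6 * p).factorial : ℝ) / (c₁ / 4) ^ (6 * p)) * Real.exp (-(c₁ / 4 * x))) * Real.exp (-(c₁ / 2 * x)) :=
        mul_le_mul_of_nonneg_right (mul_le_mul_of_nonneg_left h hG₀) hE
    _ = _ := by ring

/-- rearranging the transported kernel (`e^{−c₁M/4}·e^{c₁M/4} = 1`). [folklore] -/
private theorem kernel_rearrange {G B E₂ E₄ E₄' q l E : ℝ} (h : E₄ * E₄' = 1) :
    G * B * E₂ * E₄ * (q / l) * E₄' * E ≤ G * B * q * E₂ / l * E := by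
  apply le_of_eq
  calc G * B * E₂ * E₄ * (q / l) * E₄' * E = G * B * q * E₂ / l * E * (E₄ * E₄') := by ring
    _ = _ := by rw [h, mul_one]

set_option maxHeartbeats 6000000 in
/-- **(2.92) LINE 3 FOR THE GENUINE MEMBER OF EVERY CUBE OF THE k-LEVEL COVER — THE LAST DISPLAYED ANALYTIC HYPOTHESIS (iv) OF
`B6Prop26KLevelAssemblyV1.prop26_2136_kLevel_final_M`, PROVED**: there are `ρ₃ > 0`, `C_D ≥ 0`, `c_D > 0`, `M₃` (on `d, L` and the constants of
`B6Line3WindowV1.line3_window`) such that for every V1 global torus with `k ≥ 2`, `M_h = L^a`, `M₃ ≤ L·M_h`, `R ≥ 2L²`, `P′ ≥ 5`, `L ≥ 5`, all cubes placed,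
every fine factor `c_f ≠ 0`, all weights `w` and every cube `□`,
`ζ_□(∂(1−R)∂* − P_□)h_□` has the majorant `C_D·c_f²·e^{−c_D·LM_h}/len(y)²·e^{−ρ₃ d_T(y,y″)}` on `𝔅`.  Assembly: `line3_window` in the chart frame of `□`
for the member `t(□)` (`B6CubeWindowV1.tC`) and its family `D_□` (§1), with `χ_□ = χ_c(ctr, 8S_j/3)` (§3, `B6Line3CutoffV1`), the torus profile of
Lemma 2.1 (`B6Line3ProfileV1.profile_torus`), `κ = δ/8`, the depth `M₀ = M_h/(4L)` (§4, `B6Line3GapV1.distT_far`); then the cut from `d′` to `d_T`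
(§§5–6), the identification of the operators (§7), the block-map transport `B6TranslateTorusV1.hasMajorant_conj_chart`, and the absorption of the
member block count `|𝔅(T_□)| ≤ A₁M_h^{d+1}` into `e^{−cM_h}` (`absorb`).
[cite: Balaban1984PropagatorsII, (2.92) p.239 line 3, (2.134) p.247 («ζ_□(y) − 1 = 0 for d(y, y′) ≦ M»), p.238; assembly ours] -/
theorem line3_cube (d ℓ : ℕ) (hd : 1 ≤ d + 1) (hL : Odd (ℓ + 1) ∧ 1 < ℓ + 1) {b₀ b₁ : ℝ} (hb₀ : 0 < b₀) (hb₁ : b₀ ≤ b₁) :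
    ∃ ρ₃ CD cD M₃ : ℝ, 0 < ρ₃ ∧ 0 ≤ CD ∧ 0 < cD ∧
    ∀ (m K : ℕ) {Mh k R : ℕ} {P' : Fin (d + 1) → ℕ}
      (hN : ∀ μ, N0 ℓ Mh k P' μ = (PV d ℓ m K hd hL).sitesPerDir 0) (D : TDomains d ℓ Mh k P' R) (hk : k ≤ m + K) (_ : 2 ≤ k)
      {a : ℕ} (hMha : Mh = (ℓ + 1) ^ a) (hM8 : 8 ≤ Mh) (_ : 2 * (ℓ + 1) ^ 2 ≤ R) (hP5 : ∀ μ, 5 ≤ P' μ) (_ : 4 ≤ ℓ)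
      (hpl : ∀ c : ↥(cubes D.toDomains), Placed ℓ k P' c.1) (_ : M₃ ≤ ((ℓ : ℝ) + 1) * Mh)
      {cf : ℝ} (_ : cf ≠ 0) (w : BondIdx (domT hN D hk) → ℝ) (c : ↥(cubes D.toDomains)),
      HasMajorant (g := geomTB D) (blkV1 hN D)
        (mulOp (zB hN D (one_le_of_eight_le hM8) (four_le_of_five_le hP5) c) *
          (onFun (dE (P := PV d ℓ m K hd hL) cf ∘ₗ (LinearMap.id - RE (domT hN D hk) cf) ∘ₗ dsE cf) -
            Pl hN hk (one_le_of_eight_le hM8) (four_le_of_five_le hP5) hMha c (band_le (d := d) (ℓ := ℓ) hb₀ hb₁) (hpl c) w cf) *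
          mulOp (hB hN D c))
        (fun y y'' => CD * cf ^ 2 * Real.exp (-(cD * (geomTB D).M)) / (geomTB D).len y ^ 2 * Real.exp (-(ρ₃ * (geomTB D).dist y y''))) := by
  obtain ⟨M₁, δ, C, hM₁, hδ, hC, hwin⟩ := line3_window d ℓ hd hL
  -- ### constants (on `d, ℓ, δ, C, M₁` only)
  obtain ⟨κ, hκ⟩ : ∃ κ : ℝ, κ = δ / 8 := ⟨_, rfl⟩
  have hκ0 : 0 ≤ κ := by rw [hκ]; positivity
  have hκδ : 8 * κ ≤ δ := by rw [hκ]; linarith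
  have hδ' : 0 < δ - 2 * κ := by rw [hκ]; linarith
  obtain ⟨a₀', ha₀'⟩ : ∃ a₀' : ℝ, a₀' = min 1 ((δ - 2 * κ) / 192) := ⟨_, rfl⟩
  have ha₀'0 : 0 < a₀' := by rw [ha₀']; exact lt_min one_pos (by positivity)
  have ha₀'1 : a₀' ≤ 1 := by rw [ha₀']; exact min_le_left _ _
  have ha₀'r : a₀' ≤ (δ - 2 * κ) / 192 := by rw [ha₀']; exact min_le_right _ _
  obtain ⟨N₃, hN₃⟩ : ∃ N₃ : ℕ, N₃ = ⌈2 * ((d : ℝ) + 1) * Real.log ((ℓ : ℝ) + 1) / a₀'⌉₊ + 1 := ⟨_, rfl⟩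
  have hN₃0 : 0 < N₃ := by rw [hN₃]; exact Nat.succ_pos _
  obtain ⟨K3, hK3⟩ : ∃ K3 : ℝ, K3 = K261 N₃ (d + 1) ((ℓ : ℝ) + 1) 1 (1 * a₀') := ⟨_, rfl⟩
  have hK30 : 0 ≤ K3 := by rw [hK3]; exact K261_nonneg (by positivity) zero_le_one
  have hL0 : (0 : ℝ) < (ℓ : ℝ) + 1 := by positivity
  obtain ⟨c₁, hc₁⟩ : ∃ c₁ : ℝ, c₁ = (δ - 2 * κ) / 96 / (4 * ((ℓ : ℝ) + 1)) := ⟨_, rfl⟩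
  have hc₁0 : 0 < c₁ := by rw [hc₁]; positivity
  obtain ⟨cΔ, hcΔ⟩ : ∃ cΔ : ℝ, cΔ = ((d : ℝ) + 1) * (4 * ((ℓ : ℝ) + 1) ^ 2 + 1) := ⟨_, rfl⟩
  have hcΔ0 : 0 < cΔ := by rw [hcΔ]; positivity
  obtain ⟨A₁, hA₁⟩ : ∃ A₁ : ℝ, A₁ = 2 * (2 * ((ℓ : ℝ) + 1) ^ 3) ^ (d + 1) := ⟨_, rfl⟩
  have hA₁0 : 0 ≤ A₁ := by rw [hA₁]; positivity
  have hs₁0 : 0 ≤ D1 thetaProf := D1_thetaProf_nonneg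
  have hs₂0 : 0 ≤ D2 thetaProf := D2_thetaProf_nonneg
  have hsb0 : 0 ≤ ((d : ℝ) + 1) * D1 thetaProf := by positivity
  obtain ⟨θ, hθ⟩ : ∃ θ : ℝ, θ = ((d : ℝ) + 1) * (D1 thetaProf * C * (1 + Real.exp δ) + D2 thetaProf * C) + ((d : ℝ) + 1) * D1 thetaProf * C :=
    ⟨_, rfl⟩
  have hθ0 : 0 ≤ θ := by rw [hθ]; positivity
  obtain ⟨Θ₂, hΘ₂⟩ : ∃ Θ₂ : ℝ, Θ₂ = ((Finset.univ : Finset (Fin (d + 1) × Bool)).card : ℝ) *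
      ((((ℓ : ℝ) + 1) ^ 3) * D1 thetaProf * (Real.exp (1 + δ) * K3 * (((d : ℝ) + 1) * C))) +
    (((ℓ : ℝ) + 1) ^ 3) ^ 2 * (((d : ℝ) + 1) * D2 thetaProf + ((d : ℝ) + 1) * D1 thetaProf) * C := ⟨_, rfl⟩
  have hΘ₂0 : 0 ≤ Θ₂ := by rw [hΘ₂]; positivity
  obtain ⟨G₀, hG₀⟩ : ∃ G₀ : ℝ, G₀ = CDgk (((ℓ : ℝ) + 1) ^ 3) C C (((d : ℝ) + 1) * C) θ Θ₂ K3 := ⟨_, rfl⟩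
  have hG₀0 : 0 ≤ G₀ := by rw [hG₀]; exact CDgk_nonneg (by positivity) hC.le hC.le (by positivity) hθ0 hΘ₂0 hK30
  obtain ⟨B₆, hB₆⟩ : ∃ B₆ : ℝ, B₆ = (1 + A₁) ^ 6 * (((6 * (d + 1)).factorial : ℝ) / (c₁ / 4) ^ (6 * (d + 1))) := ⟨_, rfl⟩
  have hB₆0 : 0 ≤ B₆ := by rw [hB₆]; positivity
  -- the four constants
  refine ⟨c₁ / 4 / cΔ, G₀ * B₆, c₁ / 2 / ((ℓ : ℝ) + 1),
    max (max (((ℓ : ℝ) + 1) * M₁) (16 * ((ℓ : ℝ) + 1))) (max (8 / δ * Real.log ((ℓ : ℝ) + 1) + 1) ((N₃ : ℝ) + 1)),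
    by positivity, by positivity, by positivity, ?_⟩
  intro m K Mh k R P' hN D hk hk2 a hMha hM8 hR2 hP5 hℓ hpl hM₃ cf hcf w c
  -- ### scalars and thresholds
  have hMh1 : 1 ≤ Mh := one_le_of_eight_le hM8
  have hP4 : ∀ μ, 4 ≤ P' μ := four_le_of_five_le hP5
  have hP1 : ∀ μ, 1 ≤ P' μ := one_le_of_four_le hP4
  have hℓ1 : 1 ≤ ℓ := le_trans (by norm_num) hℓ
  have hR : 2 * (ℓ + 1) ≤ R := le_trans (by nlinarith) hR2
  have hR3 : 3 * (ℓ + 1) ≤ R := le_trans (by nlinarith) hR2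
  have hR1 : 1 ≤ R := le_trans (by omega) hR
  have hMr : (1 : ℝ) ≤ Mh := by exact_mod_cast hMh1
  have hM8r : (8 : ℝ) ≤ Mh := by exact_mod_cast hM8
  have h16r : 16 * ((ℓ : ℝ) + 1) ≤ ((ℓ : ℝ) + 1) * Mh := (le_max_right _ _).trans ((le_max_left _ _).trans hM₃)
  have hM16 : 16 ≤ Mh := by
    have : (16 : ℝ) ≤ Mh := by nlinarith
    exact_mod_cast this
  have hM₁L : ((ℓ : ℝ) + 1) * M₁ ≤ ((ℓ : ℝ) + 1) * Mh := (le_max_left _ _).trans ((le_max_left _ _).trans hM₃)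
  have hM₁Mh : M₁ ≤ (Mh : ℝ) := le_of_mul_le_mul_left hM₁L hL0
  have hM : M₁ ≤ ((ℓ : ℝ) + 1) * Mh := by nlinarith
  have hM' : M₁ ≤ ((ℓ : ℝ) + 1) * (Mh1 ℓ a : ℕ) := by
    have e : (((ℓ + 1) * Mh1 ℓ a : ℕ) : ℝ) = (Mh : ℝ) := by exact_mod_cast L_mul_Mh1 hMha hM8
    push_cast at e
    rw [e]; exact hM₁Mh
  have hlog : 8 / δ * Real.log ((ℓ : ℝ) + 1) + 1 ≤ ((ℓ : ℝ) + 1) * Mh := (le_max_left _ _).trans ((le_max_right _ _).trans hM₃)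
  have hN₃r : (N₃ : ℝ) + 1 ≤ ((ℓ : ℝ) + 1) * Mh := (le_max_right _ _).trans ((le_max_right _ _).trans hM₃)
  have hRM : 1 ≤ R * ((ℓ + 1) * Mh) := Nat.one_le_iff_ne_zero.2 (by positivity)
  have hRM₃ : N₃ + 1 ≤ R * ((ℓ + 1) * Mh) := by
    have h1 : ((N₃ + 1 : ℕ) : ℝ) ≤ (((ℓ + 1) * Mh : ℕ) : ℝ) := by push_cast; linarith
    have h2 : N₃ + 1 ≤ (ℓ + 1) * Mh := by exact_mod_cast h1
    exact h2.trans (Nat.le_mul_of_pos_left _ (by omega))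
  have hpc := hpl c
  have habs : |cf| ≠ 0 := abs_ne_zero.2 hcf
  -- ### the torus profile of the chart frame (Lemma 2.1), `κ`
  obtain ⟨hPrT, hKp0, hKanti⟩ := profile_torus (D.chart (svec ℓ k c.1.1 c.1.2)) hMh1 hP1 hN₃0 hRM₃ ha₀'0
    (by rw [hN₃]; exact budget_of_rate d ℓ ha₀'0)
  set Kp : ℝ → ℝ := fun a' => if a₀' ≤ a' then K261 N₃ (d + 1) ((ℓ : ℝ) + 1) 1 (1 * a₀')
    else max (K261 N₃ (d + 1) ((ℓ : ℝ) + 1) 1 (1 * a₀')) (Fintype.card ↥(bset (D.chart (svec ℓ k c.1.1 c.1.2)).toDomains)) with hKp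
  have hKp1 : Kp 1 = K3 := by rw [hK3]; exact if_pos ha₀'1
  have hKpr : Kp ((δ - 2 * κ) / 192) = K3 := by rw [hK3]; exact if_pos ha₀'r
  have hκRM : Real.log ((ℓ : ℝ) + 1) ≤ κ * ((geomTB (D.chart (svec ℓ k c.1.1 c.1.2))).R * (geomTB (D.chart (svec ℓ k c.1.1 c.1.2))).M) := by
    rw [geomTB_RM _ hMh1, hκ]
    have hR1r : (1 : ℝ) ≤ R := by exact_mod_cast hR1
    have hLM0 : 0 ≤ ((ℓ : ℝ) + 1) * Mh := by positivity
    have h1 : ((ℓ : ℝ) + 1) * Mh ≤ (R : ℝ) * (((ℓ : ℝ) + 1) * Mh) := by nlinarith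
    have h2 : 8 / δ * Real.log ((ℓ : ℝ) + 1) ≤ (R : ℝ) * (((ℓ : ℝ) + 1) * Mh) - 1 := by linarith
    have h3 := mul_le_mul_of_nonneg_left h2 (by positivity : (0 : ℝ) ≤ δ / 8)
    have e : δ / 8 * (8 / δ * Real.log ((ℓ : ℝ) + 1)) = Real.log ((ℓ : ℝ) + 1) := by field_simp
    linarith
  -- ### the window data of `χ_□` and the cut-offs in the chart frame
  have hMc := Mc_pos (ℓ := ℓ) hMh1 c.1.1
  have hlo := hlo_cube hMh1 hP4 c hL hℓ hM8
  have hhi := hhi_cube hN hk hMh1 hP4 hMha c (band_le (d := d) (ℓ := ℓ) hb₀ hb₁) hM8 (wC hN hk c w) cf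
  have hwn := hwin_cube hN hMh1 hP4 c hM8 hR2
  have hx₀ := hx0 (Mh := Mh) hpc
  have hfit' := hfitC hN hk hMh1 hP4 hMha c (band_le (d := d) (ℓ := ℓ) hb₀ hb₁) hpc (wC hN hk c w) cf
  have hζQ : ∀ b, zch hN hMh1 hP4 c b ≠ 0 → blkS hN (D.chart (svec ℓ k c.1.1 c.1.2)) b.src ∈ Qbig (Dch D c) (cc D hMh1 hP4 c) :=
    fun b hb => blkS_mem_Qbig_of_zch hN hMh1 hP4 c hb
  have hhQ : ∀ b, hch hN hMh1 hP4 c b ≠ 0 → blkS hN (D.chart (svec ℓ k c.1.1 c.1.2)) b.src ∈ Qbig (Dch D c) (cc D hMh1 hP4 c) :=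
    fun b hb => blkS_mem_Qbig_of_hch hN hMh1 hP4 c (by omega) hR hb
  have hS16 : (16 : ℝ) ≤ (bigSide ℓ Mh c.1.1 : ℝ) := by have := Mh_le_bigSide (ℓ := ℓ) (Mh := Mh) c.1.1; nlinarith
  have hplat : ∀ x, blkS hN (D.chart (svec ℓ k c.1.1 c.1.2)) x ∈ Qbig (Dch D c) (cc D hMh1 hP4 c) →
      ∀ μ, |lab x μ - ctr (Dch D c) (cc D hMh1 hP4 c) μ| ≤ 3 / 4 * Mc ℓ Mh c.1.1 := by
    intro x hx μ
    have h := abs_lab_sub_ctr_le hN hMh1 hP4 c hM8 hR3 hx μ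
    unfold Mc; linarith
  have hnear : ∀ x, blkS hN (D.chart (svec ℓ k c.1.1 c.1.2)) x ∈ Qbig (Dch D c) (cc D hMh1 hP4 c) →
      NearS (ctr (Dch D c) (cc D hMh1 hP4 c)) (Mc ℓ Mh c.1.1) 0 x := by
    intro x hx μ
    have h := abs_lab_sub_ctr_le hN hMh1 hP4 c hM8 hR3 hx μ
    unfold Mc; linarith
  have hζd : ∀ b, zch hN hMh1 hP4 c b ≠ 0 →
      b.src ∈ DeepS (tC hN hk hMh1 hP4 c (band_le (d := d) (ℓ := ℓ) hb₀ hb₁) a (wC hN hk c w) cf) (x0 ℓ Mh k c.1) 1 :=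
    fun b hb => deep_of_near (ctr (Dch D c) (cc D hMh1 hP4 c)) hlo hhi (r := 0) (n := 1) (by norm_num) (hnear _ (hζQ b hb))
  have hhd : ∀ b, hch hN hMh1 hP4 c b ≠ 0 →
      b.src ∈ DeepS (tC hN hk hMh1 hP4 c (band_le (d := d) (ℓ := ℓ) hb₀ hb₁) a (wC hN hk c w) cf) (x0 ℓ Mh k c.1) 1 :=
    fun b hb => deep_of_near (ctr (Dch D c) (cc D hMh1 hP4 c)) hlo hhi (r := 0) (n := 1) (by norm_num) (hnear _ (hhQ b hb))
  have htgt : ∀ b : PBond (PV d ℓ m K hd hL) 0, blkS hN (D.chart (svec ℓ k c.1.1 c.1.2)) b.src ∈ Qbig (Dch D c) (cc D hMh1 hP4 c) →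
      ∀ μ, |lab b.tgt μ - ctr (Dch D c) (cc D hMh1 hP4 c) μ| ≤ 3 / 4 * Mc ℓ Mh c.1.1 := by
    intro b hb μ
    obtain ⟨-, hlab⟩ := shift_near (ctr (Dch D c) (cc D hMh1 hP4 c)) hfit' hlo hhi (r := 0) (by norm_num) (hnear _ hb) b.dir
    have etgt : b.tgt = b.src.shift b.dir := rfl
    rw [etgt, hlab]
    by_cases hμ : μ = b.dir
    · subst hμ
      rw [Function.update_self]
      have h := abs_lab_sub_ctr_le hN hMh1 hP4 c hM8 hR3 hb b.dir
      unfold Mc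
      rw [abs_le] at h ⊢
      constructor <;> linarith [h.1, h.2]
    · rw [Function.update_of_ne hμ]
      exact hplat _ hb μ
  have hEL := hEL_cL (ctr (Dch D c) (cc D hMh1 hP4 c)) cf (zch hN hMh1 hP4 c) (fun b hb => ⟨hplat _ (hζQ b hb), htgt b (hζQ b hb)⟩)
  -- ### LINE 3 ON THE WINDOW OF THE MEMBER (p22's `line3_window`)
  have hW := hwin m K hN (D.chart (svec ℓ k c.1.1 c.1.2)) hk
    (t := tC hN hk hMh1 hP4 c (band_le (d := d) (ℓ := ℓ) hb₀ hb₁) a (wC hN hk c w) cf) (x₀ := x0 ℓ Mh k c.1) hx₀ hfit'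
    (hN1_cube hN hk hMh1 hP4 hMha c (band_le (d := d) (ℓ := ℓ) hb₀ hb₁) hM8 hR2 (wC hN hk c w) cf)
    (Dmem hN hk hMh1 hP4 c (band_le (d := d) (ℓ := ℓ) hb₀ hb₁) hk2 a (wC hN hk c w) cf)
    (hlevW_cube hN hk hMh1 hP4 hMha c (band_le (d := d) (ℓ := ℓ) hb₀ hb₁) hk2 hM8 hR2 hpc (wC hN hk c w) cf)
    (hal_cube hMh1 hP4 c hL hR2) (j0_hj hMh1 hP4 c a) (jlo := j0 hMh1 hP4 c) (fun z => jlo_cube hMh1 hP4 c z) (Nat.le_succ _)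
    hP4 hR hM one_le_Mh1 (four_le_P1 hMh1 hP4 c hℓ1) le_rfl hM' hRM hκ0 hκRM hκδ (Kp := Kp) hPrT hKp0 hKanti hcf
    (chiC hMh1 hP4 c) (cLC hMh1 hP4 c) (zoneN hN (D.chart (svec ℓ k c.1.1 c.1.2)) (chiC hMh1 hP4 c))
    (zone_nonempty hN hMh1 hP4 hMha c hℓ hM8 hpc)
    (fun x => chiS_nonneg _ _ x) (fun x => chiS_le_one _ _ x)
    (fun x hx => chi_eq_one_of_not_mem_zoneN hN _ _ x hx)
    (fun x hx => chiS_deep _ hlo hhi hMc hx)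
    (fun b hb => chiS_jump _ hx₀ hfit' hlo hhi hMc b hb)
    hs₁0 hs₂0 hsb0
    (fun b => hd1_chiS _ hx₀ hfit' hlo hhi hN _ hwn hMc b)
    (fun e x => hd1'_chiS _ hx₀ hfit' hlo hhi hN _ hwn hMc e x)
    (fun y μ => hd2_chiS _ hx₀ hfit' hlo hhi hN _ hwn hMc y μ)
    (fun x y hxy => hdb_chiS _ hN _ hwn hMc x y hxy)
    (fun y hy => chi_const_of_not_mem_zoneN hN _ _ y hy)
    (fun x => cL_mul_chiS _ hMc x)
    (zch hN hMh1 hP4 c) (hch hN hMh1 hP4 c) (abs_zch_le_one hN hMh1 hP4 c) hζd (abs_hch_le_one hN hMh1 hP4 c) hhd hEL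
    (M₀ := (Mh : ℝ) / (4 * ((ℓ : ℝ) + 1)))
    (fun v hv n hn => depth_cube hN hk hMh1 hP4 hMha c _ hk2 hℓ hM16 hR2 hP5 hpc (wC hN hk c w) cf (hζQ v hv) hn)
    (fun v hv n hn => depth_cube hN hk hMh1 hP4 hMha c _ hk2 hℓ hM16 hR2 hP5 hpc (wC hN hk c w) cf (hhQ v hv) hn)
  -- ### the member block count `|𝔅(T_□)| ≤ A₁·M_h^{d+1}`
  have hcard : (Fintype.card ↥(bset (Dmem hN hk hMh1 hP4 c (band_le (d := d) (ℓ := ℓ) hb₀ hb₁) hk2 a (wC hN hk c w) cf).toDomains) : ℝ) ≤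
      A₁ * (Mh : ℝ) ^ (d + 1) := by
    rw [Fintype.card_coe]
    have h := card_bset_famOf_le (Mh₁ := Mh1 ℓ a) (R₁ := 2 * (ℓ + 1)) (P₁ := P1 hMh1 hP4 c) (one_le_j0 hMh1 hP4 c hk2)
      (tC hN hk hMh1 hP4 c (band_le (d := d) (ℓ := ℓ) hb₀ hb₁) a (wC hN hk c w) cf).Λ'
    have hj := j0_le_level hMh1 hP4 c hL hR2
    have hfac : ∀ μ, ((Mh1 ℓ a * (ℓ + 1) ^ 2 * P1 hMh1 hP4 c μ : ℕ) : ℝ) ≤ 2 * ((ℓ : ℝ) + 1) ^ 3 * Mh := by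
      intro μ
      have e := L_mul_Mh1 hMha hM8
      have hle : (ℓ + 1) ^ (c.1.1 - j0 hMh1 hP4 c + 1) ≤ (ℓ + 1) ^ 2 := Nat.pow_le_pow_right (Nat.succ_pos ℓ) (by omega)
      have h1 : Mh1 ℓ a * (ℓ + 1) ^ 2 * (2 * (ℓ + 1) ^ (c.1.1 - j0 hMh1 hP4 c + 1)) ≤ Mh1 ℓ a * (ℓ + 1) ^ 2 * (2 * (ℓ + 1) ^ 2) :=
        Nat.mul_le_mul_left _ (Nat.mul_le_mul_left _ hle)
      have h2 : Mh1 ℓ a * (ℓ + 1) ^ 2 * (2 * (ℓ + 1) ^ 2) = 2 * (ℓ + 1) ^ 3 * ((ℓ + 1) * Mh1 ℓ a) := by ring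
      rw [h2, e] at h1
      have h3 : ((Mh1 ℓ a * (ℓ + 1) ^ 2 * (2 * (ℓ + 1) ^ (c.1.1 - j0 hMh1 hP4 c + 1)) : ℕ) : ℝ) ≤ ((2 * (ℓ + 1) ^ 3 * Mh : ℕ) : ℝ) := by
        exact_mod_cast h1
      unfold P1
      push_cast at h3 ⊢
      exact h3
    calc (((bset (Dmem hN hk hMh1 hP4 c (band_le (d := d) (ℓ := ℓ) hb₀ hb₁) hk2 a (wC hN hk c w) cf).toDomains).card : ℕ) : ℝ)
        ≤ ((2 * ∏ μ, (Mh1 ℓ a * (ℓ + 1) ^ 2 * P1 hMh1 hP4 c μ) : ℕ) : ℝ) := by exact_mod_cast h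
      _ = 2 * ∏ μ, ((Mh1 ℓ a * (ℓ + 1) ^ 2 * P1 hMh1 hP4 c μ : ℕ) : ℝ) := by push_cast; ring
      _ ≤ 2 * ∏ _μ : Fin (d + 1), (2 * ((ℓ : ℝ) + 1) ^ 3 * Mh) := by
          refine mul_le_mul_of_nonneg_left (Finset.prod_le_prod (fun μ _ => by positivity) fun μ _ => hfac μ) (by norm_num)
      _ = A₁ * (Mh : ℝ) ^ (d + 1) := by rw [Finset.prod_const, Finset.card_univ, Fintype.card_fin, hA₁, mul_pow]; ring
  -- ### the kernel of `line3_window`, cleaned: constants absorbed into `e^{−cM_h}`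
  have hΛ : 2 + (j0 hMh1 hP4 c + 1 - j0 hMh1 hP4 c) = 3 := by omega
  have hs1 : (1 : ℝ) ≤ 1 + A₁ * (Mh : ℝ) ^ (d + 1) := le_add_of_nonneg_right (by positivity)
  have hW2 := hasMajorant_mono (g := geomW hN (D.chart (svec ℓ k c.1.1 c.1.2)) hx₀ hfit'
      (hN1_cube hN hk hMh1 hP4 hMha c (band_le (d := d) (ℓ := ℓ) hb₀ hb₁) hM8 hR2 (wC hN hk c w) cf)
      (Dmem hN hk hMh1 hP4 c (band_le (d := d) (ℓ := ℓ) hb₀ hb₁) hk2 a (wC hN hk c w) cf))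
    (blkV1 hN (D.chart (svec ℓ k c.1.1 c.1.2))) hW (K' := fun a' b' =>
      G₀ * B₆ * Real.exp (-(c₁ / 2 * Mh)) * Real.exp (-(c₁ / 4 * Mh)) * (cf ^ 2 /
        (geomW hN (D.chart (svec ℓ k c.1.1 c.1.2)) hx₀ hfit'
            (hN1_cube hN hk hMh1 hP4 hMha c (band_le (d := d) (ℓ := ℓ) hb₀ hb₁) hM8 hR2 (wC hN hk c w) cf)
            (Dmem hN hk hMh1 hP4 c (band_le (d := d) (ℓ := ℓ) hb₀ hb₁) hk2 a (wC hN hk c w) cf)).len a' ^ 2) *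
        Real.exp (-((δ - 2 * κ) / 192 *
          (geomW hN (D.chart (svec ℓ k c.1.1 c.1.2)) hx₀ hfit'
            (hN1_cube hN hk hMh1 hP4 hMha c (band_le (d := d) (ℓ := ℓ) hb₀ hb₁) hM8 hR2 (wC hN hk c w) cf)
            (Dmem hN hk hMh1 hP4 c (band_le (d := d) (ℓ := ℓ) hb₀ hb₁) hk2 a (wC hN hk c w) cf)).dist a' b'))) (by
    intro a' b'
    refine mul_le_mul_of_nonneg_right ?_ (Real.exp_pos _).le
    rw [hKp1, hKpr, hΛ, div_pow, sq_abs, div_div_eq_mul_div, mul_div_assoc]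
    refine mul_le_mul_of_nonneg_right ?_ (by positivity)
    have he₀ : (δ - 2 * κ) / 96 * ((Mh : ℝ) / (4 * ((ℓ : ℝ) + 1))) = c₁ * Mh := by rw [hc₁]; field_simp
    -- `θ₂` does not depend on the fine factor
    have hu : |cf| * |cf|⁻¹ = 1 := mul_inv_cancel₀ habs
    have hθeq : ((Finset.univ : Finset (Fin (d + 1) × Bool)).card : ℝ) *
          ((((ℓ : ℝ) + 1) ^ 3) * (|cf| * D1 thetaProf) * (Real.exp (1 + δ) * K3 * |cf|⁻¹ * (((d : ℝ) + 1) * |cf|⁻¹ * C) * |cf|) +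
            (((ℓ : ℝ) + 1) ^ 3) ^ 2 * 0 * C) +
          (((ℓ : ℝ) + 1) ^ 3) ^ 2 * (((d : ℝ) + 1) * D2 thetaProf + ((d : ℝ) + 1) * D1 thetaProf) * C = Θ₂ := by
      rw [hΘ₂]
      have e : (((ℓ : ℝ) + 1) ^ 3) * (|cf| * D1 thetaProf) * (Real.exp (1 + δ) * K3 * |cf|⁻¹ * (((d : ℝ) + 1) * |cf|⁻¹ * C) * |cf|) =
          (((ℓ : ℝ) + 1) ^ 3) * D1 thetaProf * (Real.exp (1 + δ) * K3 * (((d : ℝ) + 1) * C)) := by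
        calc _ = (((ℓ : ℝ) + 1) ^ 3) * D1 thetaProf * (Real.exp (1 + δ) * K3 * (((d : ℝ) + 1) * C)) * (|cf| * |cf|⁻¹) *
            (|cf| * |cf|⁻¹) := by ring
          _ = _ := by rw [hu]; ring
      rw [e]; ring
    rw [he₀, div_one, hθeq, ← hθ]
    have hKx0 : 0 ≤ K3 * (1 + (Fintype.card ↥(bset (Dmem hN hk hMh1 hP4 c (band_le (d := d) (ℓ := ℓ) hb₀ hb₁) hk2 a
        (wC hN hk c w) cf).toDomains) : ℝ)) := by positivity
    have hL3 : (0 : ℝ) ≤ ((ℓ : ℝ) + 1) ^ 3 := by positivity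
    have hC₁ : (0 : ℝ) ≤ ((d : ℝ) + 1) * C := by positivity
    refine (mul_le_mul_of_nonneg_right (CDgk_mono (Kx' := (1 + A₁ * (Mh : ℝ) ^ (d + 1)) * K3)
      hL3 hC.le hC.le hC₁ hθ0 hΘ₂0 hKx0 le_rfl ?_) (Real.exp_pos _).le).trans ?_
    · rw [mul_comm]
      exact mul_le_mul_of_nonneg_right (by linarith [hcard]) hK30
    · refine (mul_le_mul_of_nonneg_right (CDgk_scale hL3 hC.le hC.le hC₁ hθ0 hΘ₂0 hK30 hs1) (Real.exp_pos _).le).trans ?_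
      rw [← hG₀]
      have h := absorb (d + 1) hG₀0 hc₁0 hMr hA₁0 (s := 1 + A₁ * (Mh : ℝ) ^ (d + 1)) rfl le_rfl
      rw [← hB₆] at h
      exact h)
  -- ### the cut from `d′` to `d_T` (located pairs have diameter `≤ c_Δ·M_h`)
  have hdiam : ∀ v, zch hN hMh1 hP4 c v ≠ 0 → ∀ v', hch hN hMh1 hP4 c v' ≠ 0 →
      (geomTB (D.chart (svec ℓ k c.1.1 c.1.2))).dist (blkV1 hN (D.chart (svec ℓ k c.1.1 c.1.2)) v)
        (blkV1 hN (D.chart (svec ℓ k c.1.1 c.1.2)) v') ≤ cΔ * Mh := by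
    intro v hv v' hv'
    rw [hcΔ]
    exact distT_le_of_mem_Qbig hMh1 hP4 c hL hM8 hR2 (hζQ v hv) (hhQ v' hv')
  have hcut := hasMajorant_cut_of_diam hN (D.chart (svec ℓ k c.1.1 c.1.2)) hx₀ hfit'
    (hN1_cube hN hk hMh1 hP4 hMha c (band_le (d := d) (ℓ := ℓ) hb₀ hb₁) hM8 hR2 (wC hN hk c w) cf)
    (Dmem hN hk hMh1 hP4 c (band_le (d := d) (ℓ := ℓ) hb₀ hb₁) hk2 a (wC hN hk c w) cf)
    (zch hN hMh1 hP4 c) (hch hN hMh1 hP4 c) hW2 hdiam (by positivity) (ρ := c₁ / 4 / cΔ) (by positivity)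
  -- ### the chart-frame operator, then the global frame
  have hchart := hasMajorant_of_eq (g := geomT (D.chart (svec ℓ k c.1.1 c.1.2))) (blk' := blkV1 hN (D.chart (svec ℓ k c.1.1 c.1.2)))
    (chart_eq_line3 hN hk hMh1 hP4 hMha c (band_le (d := d) (ℓ := ℓ) hb₀ hb₁) hk2 hM8 hR2 hpc (wC hN hk c w) hcf hζd hhd)
    (hasMajorant_T_of_TB hN hcut)
  rw [target_eq_conj hN hk hMh1 hP4 hMha c (band_le (d := d) (ℓ := ℓ) hb₀ hb₁) hpc w cf]
  refine hasMajorant_TB hN (hasMajorant_conj_chart hN D hMh1 hP1 (svec ℓ k c.1.1 c.1.2) hchart ?_ ?_)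
  · intro a' b'
    have hdist : (geomTB D).dist (blkMap D (svec ℓ k c.1.1 c.1.2) a') (blkMap D (svec ℓ k c.1.1 c.1.2) b') =
        (geomTB (D.chart (svec ℓ k c.1.1 c.1.2))).dist a' b' := by
      show (((bondT D).dist _ _ : ℕ) : ℝ) = (((bondT (D.chart (svec ℓ k c.1.1 c.1.2))).dist a' b' : ℕ) : ℝ)
      rw [distT_chart_eq hMh1 hP1]
    have e1 : c₁ / 4 / cΔ * (cΔ * Mh) = c₁ / 4 * Mh := by field_simp
    have e2 : c₁ / 2 / ((ℓ : ℝ) + 1) * (((ℓ : ℝ) + 1) * Mh) = c₁ / 2 * Mh := by field_simp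
    rw [geomW_len, geomTB_M, geomTB_len, geomTB_len, blkMap_fst D hMh1 hP1, hdist, e1, e2]
    have h1 : Real.exp (-(c₁ / 4 * (Mh : ℝ))) * Real.exp (c₁ / 4 * (Mh : ℝ)) = 1 := by
      rw [← Real.exp_add, neg_add_cancel, Real.exp_zero]
    exact kernel_rearrange h1
  · intro a' b'; positivity

/-- **PROPOSITION 2.6 (2.136)₁ AT k LEVELS FOR THE GENUINE `G = Δ_a⁻¹` OF THE V1 TORUS — NO DISPLAYED ANALYTIC HYPOTHESIS**
(`B6Prop26KLevelAssemblyV1.prop26_2136_kLevel_final_M` with its last hypothesis, line 3 of (2.92) for the cube member, discharged by `line3_cube`;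
rate `σ ≤ min(σ₀, ρ₃/2)`): for every weight band `[b₀, b₁]` there is `σ₁ > 0` such that for all `0 < σ ≤ σ₁`, `0 < α ≤ 1` there are `A ≥ 0`, `M₂ > 0`
with: every V1 global torus with `k ≥ 2`, `M_h = L^a ≥ 8`, `M₂ ≤ L·M_h`, `R ≥ 2L²`, `P′ ≥ 5`, `L = 5`, all cubes placed, weights in the band, has
`|G(x, x′)| ≤ A·(L^{j(y)}/c_f)²·e^{−δ₃(α, 2σ)·d_T(y, y′)}`.  The remaining hypotheses are print's SETTING ((2.2): `M` large, `R ≥ 2L²`; (2.16): the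
weight band; the V1 torus with `L = 5`, `P′ ≥ 5`, the placement of the top cubes), not analytic inputs.
[cite: Balaban1984PropagatorsII, Prop. 2.6 (2.136) p.247, (2.92) p.239, Lemma 2.1 p.234] -/
theorem prop26_2136_kLevel_unconditional (d ℓ : ℕ) (hd : 1 ≤ d + 1) (hL : Odd (ℓ + 1) ∧ 1 < ℓ + 1) {b₀ b₁ : ℝ} (hb₀ : 0 < b₀)
    (hb₁ : b₀ ≤ b₁) :
    ∃ σ₁ : ℝ, 0 < σ₁ ∧ ∀ (σ : ℝ), 0 < σ → σ ≤ σ₁ → ∀ (α : ℝ), 0 < α → α ≤ 1 →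
    ∃ A M₂ : ℝ, 0 ≤ A ∧ 0 < M₂ ∧
    ∀ (m K : ℕ) {Mh k R : ℕ} {P' : Fin (d + 1) → ℕ}
      (hN : ∀ μ, N0 ℓ Mh k P' μ = (PV d ℓ m K hd hL).sitesPerDir 0) (D : TDomains d ℓ Mh k P' R) (hk : k ≤ m + K) (_ : 2 ≤ k)
      {a : ℕ} (_ : Mh = (ℓ + 1) ^ a) (_ : 8 ≤ Mh) (_ : 2 * (ℓ + 1) ^ 2 ≤ R) (_ : ∀ μ, 5 ≤ P' μ) (_ : 4 ≤ ℓ)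
      (_ : ∀ c : ↥(cubes D.toDomains), Placed ℓ k P' c.1) (_ : M₂ ≤ ((ℓ : ℝ) + 1) * Mh)
      {cf : ℝ} (hcf : cf ≠ 0) {w : BondIdx (domT hN D hk) → ℝ} (hw : ∀ i, 0 < w i) (_ : GlobalBand b₀ b₁ cf w),
      HasMajorant (g := geomT D) (blkV1 hN D) (onFun (GE (domT hN D hk) hcf hw))
        (fun y y' => A * pref cf y * Real.exp (-(delta3 α (2 * σ) * (geomT D).dist y y'))) := by
  obtain ⟨ρ₃, CD, cD, M₃, hρ₃, hCD, hcD, hcube⟩ := line3_cube d ℓ hd hL hb₀ hb₁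
  obtain ⟨σ₀, hσ₀, hfin⟩ := prop26_2136_kLevel_final_M d ℓ hd hL hb₀ hb₁
  refine ⟨min σ₀ (ρ₃ / 2), lt_min hσ₀ (by linarith), fun σ hσ hσ1 α hα hα1 => ?_⟩
  obtain ⟨A, M₂, hA, hM₂, h⟩ := hfin σ hσ (hσ1.trans (min_le_left _ _)) α hα hα1 hCD hcD
  refine ⟨A, max M₂ M₃, hA, lt_max_of_lt_left hM₂, ?_⟩
  intro m K Mh k R P' hN D hk hk2 a hMha hM8 hR2 hP5 hℓ hpl hM cf hcf w hw hwb
  have hσρ : 2 * σ ≤ ρ₃ := by linarith [hσ1.trans (min_le_right _ _)]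
  refine h m K hN D hk hk2 hMha hM8 hR2 hP5 hℓ hpl ((le_max_left _ _).trans hM) hcf hw hwb fun c => ?_
  refine hasMajorant_mono (g := geomTB D) (blkV1 hN D) (hcube m K hN D hk hk2 hMha hM8 hR2 hP5 hℓ hpl ((le_max_right _ _).trans hM) hcf w c) ?_
  intro y y''
  have hd0 : 0 ≤ (geomTB D).dist y y'' := Nat.cast_nonneg _
  refine mul_le_mul_of_nonneg_left (Real.exp_le_exp.2 (by nlinarith)) ?_
  have := B6Prop26KLevelAssemblyV1.lenTB_pos (D := D) y
  positivity

/-- **PROPOSITION 2.6 (2.136)₁ AT k LEVELS FOR THE GENUINE `G`, AT `L = 5`, `P′_μ ≥ 12`: THE PLACEMENT DISCHARGED** (the canonical index-`2` chart places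
every cube, `B6CubeWindowV1.placed_all_cubes`), so that only print's setting ((2.2) `M` large, `R ≥ 2L²`; (2.16) the weight band; the V1 torus with
`k ≥ 2`, `P′ ≥ 12`) remains as hypotheses. [cite: Balaban1984PropagatorsII, Prop. 2.6 (2.136) p.247, (2.2) p.224, (2.16) p.225] -/
theorem prop26_2136_kLevel_unconditional_L5 (d : ℕ) (hd : 1 ≤ d + 1) (hL : Odd (4 + 1) ∧ 1 < 4 + 1) {b₀ b₁ : ℝ} (hb₀ : 0 < b₀)
    (hb₁ : b₀ ≤ b₁) :
    ∃ σ₁ : ℝ, 0 < σ₁ ∧ ∀ (σ : ℝ), 0 < σ → σ ≤ σ₁ → ∀ (α : ℝ), 0 < α → α ≤ 1 →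
    ∃ A M₂ : ℝ, 0 ≤ A ∧ 0 < M₂ ∧
    ∀ (m K : ℕ) {Mh k R : ℕ} {P' : Fin (d + 1) → ℕ}
      (hN : ∀ μ, N0 4 Mh k P' μ = (PV d 4 m K hd hL).sitesPerDir 0) (D : TDomains d 4 Mh k P' R) (hk : k ≤ m + K) (_ : 2 ≤ k)
      {a : ℕ} (_ : Mh = (4 + 1) ^ a) (_ : 8 ≤ Mh) (_ : 2 * (4 + 1) ^ 2 ≤ R) (_ : ∀ μ, 12 ≤ P' μ) (_ : M₂ ≤ (((4 : ℕ) : ℝ) + 1) * Mh)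
      {cf : ℝ} (hcf : cf ≠ 0) {w : BondIdx (domT hN D hk) → ℝ} (hw : ∀ i, 0 < w i) (_ : GlobalBand b₀ b₁ cf w),
      HasMajorant (g := geomT D) (blkV1 hN D) (onFun (GE (domT hN D hk) hcf hw))
        (fun y y' => A * pref cf y * Real.exp (-(delta3 α (2 * σ) * (geomT D).dist y y'))) := by
  obtain ⟨σ₁, hσ₁, h⟩ := prop26_2136_kLevel_unconditional d 4 hd hL hb₀ hb₁
  refine ⟨σ₁, hσ₁, fun σ hσ hσ1 α hα hα1 => ?_⟩
  obtain ⟨A, M₂, hA, hM₂, h2⟩ := h σ hσ hσ1 α hα hα1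
  refine ⟨A, M₂, hA, hM₂, ?_⟩
  intro m K Mh k R P' hN D hk hk2 a hMha hM8 hR2 hP12 hM cf hcf w hw hwb
  exact h2 m K hN D hk hk2 hMha hM8 hR2 (fun μ => le_trans (by norm_num) (hP12 μ)) le_rfl
    (B6CubeWindowV1.placed_all_cubes rfl hP12) hM hcf hw hwb

end Main

end Literature.MathematicalPhysics.QuantumFieldTheory.Balaban1983to89.B6Line3CubeV1

end
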